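import Literature.MathematicalPhysics.QuantumFieldTheory.Balaban1983to89.T4CondMeanChannelInsert
import Literature.MathematicalPhysics.QuantumFieldTheory.Balaban1983to89.T4AvgDerivBound

/-!
# `Balaban1983to89.T4SeparableFibreExpansion` — the WEIGHT CHART of the (CM) channel for (products of) loop variables
# of iterated averages: the SEPARABLE FIBRE EXPANSION of the weight in ONE-BOND INCREMENTS at a reference point, its
# remainder as a sum of MIXED SECOND DIFFERENCES along the path lattice, and the junction BY NAME with the row's typed
# averaging shapes `T4AvgDerivBound.LoopDerivBound` / `LoopPairDerivBound` on a `FibreConvex` domain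
# (cell T4, node O3.E-i′ (β) / NE1′-TEL; bookkeeping seam; answers the typing request CLAIMS l.51159 (Q-av-Lip))

HONEST FRAMING.  Audit cell `pub-balaban`, unit `b2b-balaban-pv16-g13` (SURGE NODE PROVER #16, lineage continuation of
`T4CondMeanChannelInsert`, generation 12; companion record `HOME/t4/T4-EST-O3Ei1.md`).  The cell's T4 target is the
existence and uniqueness of the continuum limit of unit-scale averaged loop expectations on a FINITE torus, with
Bałaban's densities as GIVEN data satisfying the printed end statement (B) as a HYPOTHESIS; it is NOT an infinite-volume
statement, NOT a mass gap, NOT the Clay problem, and this module is NOT progress on any summit.  Value = a kernel-checked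
JUNCTION and nothing more.  The question it answers (t4-lean-g16, CLAIMS l.51159, on t4-ne1p-p3-g4's (Q-av-Lip)
l.50983: «state in (W1)'s signature precisely which modulus `condMeanGap_…` consumes») concerns the WEIGHT CHART of
`T4CondMeanChannelInsert.condMeanGap_of_suppression` — binders `hq₁`/`hq₂`: «the weight minus a fibre-independent
reference minus a linearised fibre reading is small on the live configurations».  ANSWER, typed here: take `E = ℝ`,
`β = s`, `t = 1`, unit amplitudes, the reference `m V = g(V ← y₀)` and as linearised reading the INCREMENT READING
`b ↦ g(V₀ ← (y₀; b ← y_b)) − g(V₀ ← y₀)` (the one-bond increments of the weight at a reference point `(V₀, y₀)`);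
then the chart remainder IS the additive-separability remainder
`fibreSepRem = g(V←y) − g(V←y₀) − Σ_{b∈s} [g(V₀←(y₀;b←y_b)) − g(V₀←y₀)]` (`chart_eq_fibreSepRem`), an alternating sum
of MIXED SECOND DIFFERENCES along the path lattice between `V₀ ← y₀` and `V ← y` (§1), hence bounded by a PAIR BUDGET
summed over (fibre bond, any other bond) pairs.  For `g` a loop variable — or a product of loop variables — of the
`n`-fold iterated average, the pair budget is EXACTLY the row's typed shape `T4AvgDerivBound.LoopPairDerivBound av dom
C₂ θ₂` (products add the cross terms `LoopDerivBound × LoopDerivBound` by the discrete Leibniz rule, `|W| ≤ 1`), on a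
`FibreConvex dom` containing both endpoints (§2).  So the averaging-side modulus the (CM) channel consumes is NOT a new
one-step per-bond Lipschitz predicate: it is the pair `LoopDerivBound` (sizes of the increments) + `LoopPairDerivBound`
(the remainder) of `T4AvgDerivBound` (unit b07-g5), used BY NAME.  A first-difference shape ALONE bounds a mixed
difference only by twice a first difference (`T4AvgDerivBound.mixed_le_two_mul_of_loopDerivBound`), i.e. gives a
remainder of the SAME order as the increments and no channel gain; a sup-Lipschitz modulus alone gives amplitude `0` and
the oscillation remainder, i.e. route (F) `T4ObservableTelescope.abs_termDefect_le_of_osc`.  The one-step origin of the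
pair shape (a second-order chain rule across `n` averaging steps from a one-step bilinear sensitivity, expected rate
`θ₂ ≍ θ₁²`) is NOT in the tree and NOT claimed (located, unowned; `T4AvgDerivBound` §5).

CITATION HEADER.  Nothing of T. Bałaban's series (CMP 1984–89) is newly read, quoted or attributed here.  The averagings
enter ONLY through the tree's axioms `Setup.Averaging` and the HYPOTHESIS SHAPES `LoopDerivBound`, `LoopPairDerivBound`,
`FibreConvex` of `T4AvgDerivBound`, whose header carries the verbatim context quotations [Balaban1985Averaging] (11),
(15) p. 19 and flags the site-summable sensitivity profile as programme MODEL, not print; the term structure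
(`TermProvisos`, `liveSet`, `CondMeanGap`, `CondMeanSuppression`, `condMeanField`, `fibreReading`, `linDensity`) is the
cell's typed model of one term of [Balaban1989LargeFieldI] (0.3)/(1.100) as documented in `T4ObservableTelescope`,
`T4CondMeanChannel`, `T4CondMeanChannelInsert`, re-used BY NAME.  ABSOLUTE RULE honoured: no programme-internal
statement is an input; every declaration below is [folklore] bookkeeping (finite sums, `abs`, induction on finsets and
lists).

NEW vs PRINTED-TYPE.  PRINTED-TYPE: none newly used.  CELL MODEL typed EARLIER (by name): the (CM) channel and its
chart format (pv16 gen 11–12), the averaging shapes and `bdist`/`tv`/`iterFrom` (b07-g5, pv16 `T4AvgSensitivity`),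
`|W| ≤ 1` and measurability of loop variables (`T4Continuum`, regular gauge groups).  NEW HERE (kernel, [folklore]): the
path-lattice calculus (§1), the fibre dictionary and the loop / loop-product budgets (§2), the increment reading and the
two junction theorems (§3).

WHAT IS PROVED (all [folklore]; no `sorry`, no new axiom):
§1 (abstract: `h : (ι → X) → ℝ`, path lattice `pathPt U₁ U₀ T = T.piecewise U₁ U₀`) `sqDiff`, `SqBound`, `FdBound`,
   `rect₁`, `rect₀`, `sepRem₀`, `sepRem`; `abs_rect₁_le`, `abs_sepRem₀_le`, `abs_rect₀_le`, `abs_sepRem_le`: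
   `|h(S∪X-point) − h(X-point) − Σ_{b∈S}(h({b}-point) − h U₀)| ≤ Σ_{b∈S,c∈X} M b c + Σ_{b,c∈S} M b c` (`S, X` disjoint,
   `M ≥ 0`); `sepRem_eq_zero_of_sqBound_zero` (exactness for additively separable `h`); `sqBound_of_abs_le`; the
   discrete Leibniz rule `sqDiff_mul`, `fdBound_mul`, `sqBound_mul`, and `listProd_budget` (a product of factors bounded
   by `1` with product-form budgets `μ_a d_b d_c`, `ν_a d_b` has budgets `(Σμ + (Σν)²) d_b d_c`, `(Σν) d_b`);
   `sum_sum_prodBudget`.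
§2 (fibre of a level-`k` configuration over `s`) `bondIncr`, `fibreSepRem`, `pathPt_union_compl`, `pathPt_compl`,
   `pathPt_singleton`, `fibreSepRem_eq_sepRem`, `abs_fibreSepRem_le`, `abs_fibreSepRem_le_of_prodBudget`:
   `|fibreSepRem| ≤ μ·(Σ_{b∈s} bdist(y₀ b, y b))·tv(V₀←y₀, V←y)`; `pathPt_mem` (fibre convexity); `sqBound_loop`
   (`LoopPairDerivBound` ⇒ pair budget `(C₂|w|θ₂ⁿ)·bdist_b·bdist_c`), `fdBound_loop` (`LoopDerivBound` ⇒
   `(C₁|w|θ₁ⁿ)·bdist_b`), `abs_fibreSepRem_loop_le`, `abs_bondIncr_loop_le` (`|increment| ≤ C₁|w|θ₁ⁿ·bdist`);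
   `loopProd_budget`, `abs_fibreSepRem_loopProd_le`; the named weight `loopProdW av k n ws` (+ `loopProdW_eq_comp`,
   `abs_loopProdW_le_one`, `measurable_iterFrom`, `measurable_loopProdW`), the rate `loopProdRate` (+ `_nonneg`),
   `abs_fibreSepRem_loopProdW_le`: `|fibreSepRem| ≤ (Σᵢ C₂|wᵢ|θ₂ⁿ + (Σᵢ C₁|wᵢ|θ₁ⁿ)²)·(fibre variation)·(total variation)`.
§3 `incrReading` (= `fibreReading` of the increments; `incrReading_apply`), `chart_eq_fibreSepRem`;
   `condMeanGap_of_separable`: `condMeanGap_of_suppression` with the increment reading ⇒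
   `CondMeanGap s ins old g ((|s|·lip₁·d₁ + q₁) + (|s|·lip₂·d₂ + q₂))` from bounds `qᵢ` on `|fibreSepRem|` over the
   live configurations; `condMeanGap_of_loopProd`: the COMPLETE HYPOTHESIS LIST for `g = loopProdW av j n ws` —
   averaging side `LoopDerivBound` + `LoopPairDerivBound` + `FibreConvex` (b07, by name), law side two
   `CondMeanSuppression` data for the increment reading, cover/window `V←y ∈ dom j` with
   `(Σ_b bdist(y₀ b, y b))·tv(V₀←y₀, V←y) ≤ Δᵢ` on the live configurations — ⇒
   `CondMeanGap … ((|s|·lip₁·d₁ + rate·Δ₁) + (|s|·lip₂·d₂ + rate·Δ₂))`.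
§4 [v1.1, append-only] the LOCAL-REFERENCE variant (reference exterior = the configuration's own): `incrReadingLoc`
   (`incrReadingLoc_updateFinset`: on the fibre through `V` it reads `bondIncr s g V y₀ y`), `chartLoc_eq_fibreSepRem`,
   `tv_updateFinset_updateFinset` (same exterior ⇒ `tv` = fibre variation), `abs_fibreSepRem_loopProdW_loc_le`:
   `|fibreSepRem s (loopProdW …) V y₀ V y| ≤ rate·(Σ_{b∈s} bdist(y₀ b, y b))²` — NO exterior term;
   `condMeanGap_of_separableLoc`, `condMeanGap_of_loopProdLoc` (complete hypothesis list, cover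
   `V←y₀, V←y ∈ dom j ∧ (fibre variation)² ≤ Δᵢ` on the live configurations).
§5 [v1.2, append-only] the DIAGONAL of the increment reading: the bond reflection `bondReflect y₀ b` (`y_b ↦
   y₀_b·y_b⁻¹·y₀_b`; an involution fixing `y₀`, `bdist`-preserving, measurable for a regular gauge group;
   `bondReflectEquiv`), the odd / even parts `oddIncr` / `evenIncr` of the one-bond increment (`oddIncr_add_evenIncr`,
   `oddIncr_bondReflect`, `evenIncr_bondReflect`, `two_mul_evenIncr`: `2·even = g(V₀←(y₀;b←y_b)) − 2g(V₀←y₀) +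
   g(V₀←(y₀;b←y₀_b y_b⁻¹ y₀_b))` — half a ONE-BOND SYMMETRIC SECOND DIFFERENCE), `integral_oddIncr_eq_zero` (EXACT mean
   vanishing of the odd part under a `bondReflect y₀ b`-invariant law — the symmetry a binder), the readings `oddReading`
   / `evenReading` (`incrReading_eq_odd_add_even`), `meanVanishes_oddReading`, `condMeanSuppression_oddReading_of_
   varianceBound` (the (β) supplier `T4CondMeanChannelInsert.condMeanSuppression_reading_of_varianceBound` applies to
   the ODD reading BY NAME, its `hflat` discharged from the reflection symmetry of the reference conditional law in every
   bond of `s`), `abs_condMean_evenReading_le` (the even reading's conditional mean is bounded only by SIZE: `≤ ∫ D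
   d(condLaw)` for any integrable majorant `D`), `condMeanSuppression_incrReading_of_split` (the channel's law-side datum
   for the increment reading assembled from the split: deviation functional `lip·dev + κ` with the diagonal FLOOR `κ`).
§6 [v1.3, append-only] the symmetry binder DISCHARGED TO THE WEIGHT: `measurePreserving_reflect` (`h ↦ a·h⁻¹·a`
   preserves the Haar datum: the three invariance fields of `HaarData`), `measurePreserving_bondReflect` (the product
   Haar measure on the fibre is `bondReflect`-invariant, `measurePreserving_pi`), `map_bondReflect_fibreLaw` /
   `map_bondReflect_condLaw` (the fibre / conditional law is reflection-invariant as soon as the DENSITY is, on that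
   fibre), `weightSymm_of_radial` (sufficient: the density depends on `y_b` only through `bdist (y₀ b) y_b` given the
   other fibre variables), `condMeanSuppression_oddReading_of_weightSymm` (§5's odd-reading supplier with `hsym`
   replaced by the weight's reflection symmetry `hwsym`).

HONEST SCOPE / NOT PROVED.  (i) NO INSTANCE of `LoopDerivBound`, `LoopPairDerivBound`, `FibreConvex`, `DomStable` for
Bałaban's averaging operations is proved here or anywhere in the tree (b07's binders; the pair shape has no one-step
supplier at all).  (ii) THE REMAINDER'S STRUCTURE, stated plainly: `Δ` bounds FIBRE VARIATION × TOTAL VARIATION between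
the reference configuration `V₀ ← y₀` and the live configurations `V ← y`, and the total variation runs over ALL bonds of
the level-`j` lattice on which the live exteriors differ from the reference exterior; the typed pair shape carries NO
decay in the distance between the two bonds (its budget is location-independent, `T4AvgDerivBound` (M) is a profile in
the LOOP's position only), so AS TYPED `Δ` is (fibre diameter) × (window diameter summed over the lattice).  Whether the
K-uniform count absorbs this is NOT decided here (no FIRE / no-FIRE verdict; GAPS row G-pv16g13-2 records the located
obligation: either a pair shape localised in BOTH bonds, or windows whose exterior variation is controlled, or a
reference exterior per exterior class — §4, next item).  (ii′) [v1.1] THE TWO REFERENCE CONVENTIONS, the trade-off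
stated plainly.  FIXED reference `(V₀, y₀)` (§3): the increment reading is exterior-INDEPENDENT (a `fibreReading`), so
the (β)-currency supplier `T4CondMeanChannelInsert.condMeanSuppression_reading_of_varianceBound` (one reference
exterior per law, `MeanVanishes` there) applies BY NAME — but the remainder carries the EXTERIOR total variation.  LOCAL
reference `(V, y₀)` (§4): the remainder is `rate·(fibre variation)²`, second order in the fibre displacement with NO
exterior term — but the reading `incrReadingLoc` is exterior-DEPENDENT, and the law-side datum
`CondMeanSuppression domᵢ (condMeanField s w (incrReadingLoc s g y₀)) univ devᵢ lipᵢ` is NOT an instance of that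
supplier as typed (it takes ONE exterior-independent `B`, flat under ONE reference law): per live exterior `V` it needs
the flatness of the `V`-dependent fibre function `y ↦ g(V ← (y₀; b ← y_b)) − g(V ← y₀)` under the reference law, i.e.
a symmetry argument UNIFORM in `V` (the format of `T4FlatExteriorInvariance`, unit pv04, to be checked by its owner) —
located, unowned.  Neither convention is asserted here to close the count.  (ii″) [v1.2] THE DIAGONAL, stated
plainly (this CORRECTS the emphasis of (ii′)): for `Φ` = one-bond INCREMENTS (either convention) the supplier's flatness
input `MeanVanishes` under the reference law does NOT hold for the full increment — only for its ODD part under the bond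
reflections through the reference (§5, given the reflection symmetry of the reference conditional law: a binder, the
record's obligation O-α — by §6 [v1.3] IMPLIED BY the reflection symmetry of the WEIGHT on the reference fibre, the
Haar part being kernel-settled; which printed weights / references are symmetric is NOT touched); the EVEN part is half a one-bond symmetric second difference of the weight whose
conditional mean SURVIVES at the reference law (the diagonal self-energy of the record's §5 (γ1): for a `U(1)` plaquette
weight `cos`, `E[cos(θ₀+δ)] − cos θ₀ = cos θ₀·(E cos δ − 1) ≠ 0` under a symmetric law).  Hence the law-side datum `hsupᵢ`
for the increment reading is available only with a deviation FLOOR `κᵢ` (`condMeanSuppression_incrReading_of_split`: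
`lip·dev + κ`), `κᵢ u ≥ |E^{wᵢ}[evenReading | u]|`, bounded here only by SIZE (`abs_condMean_evenReading_le`; a
θ₂-type smallness of the even part would need a ONE-BOND SECOND-ORDER modulus of the weight — b07's pair shape requires
two DISTINCT bonds and does not provide it — untyped, unowned), and the channel's output then carries `|s|·κᵢ` per
law; whether the count absorbs it is the record's (γ1) question, NOT decided here.  (iii) COVER: `V ← y ∈ dom j` on the live configurations and `V₀ ← y₀ ∈ dom j`
are binders ((R-b) of record `T4-EST-O3Ei1.md`).  (iv) LAW SIDE: the two `CondMeanSuppression` data for the increment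
reading are binders — supplied in the (β) currency from (VAR) binders by `T4CondMeanChannelInsert` §3 /
`T4CovarianceResponse`, or on cube charts (unit pv28); the increments are bounded measurable fibre readings of
oscillation `≤ C₁|w|θ₁ⁿ·bdist` (`abs_bondIncr_loop_le`), which is what those suppliers need.  (v) `loopProdW` is stated
for lists of (base site, word) pairs at level `k + n` with closedness hypotheses; its identification with
`T4ObservableTelescopeTwoRun.prodLoop` pulled back by `pullback av k n` (`ULoop.atLevel = walk (toLevel …) word`,
`pullback av k n f = f ∘ iterFrom av k n`, cf. `loopProdW_eq_comp`) is a consumer one-liner and is NOT imported (import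
hygiene: this leaf imports only `T4CondMeanChannelInsert` and `T4AvgDerivBound`).  (vi) No rates, no K-uniformity, no
summation over terms or steps, no statement about Bałaban's densities or averagings.
-/

open _root_.MeasureTheory
open Function (updateFinset)
open scoped BigOperators InnerProductSpace ENNReal

namespace Literature.MathematicalPhysics.QuantumFieldTheory.Balaban1983to89.T4SeparableFibreExpansion

open Literature.MathematicalPhysics.QuantumFieldTheory.Balaban1983to89

/-! ## §1 The abstract separable expansion along the path lattice between two configurations -/

section Abstract

variable {ι : Type*} [DecidableEq ι] {X : Type*}

/-- THE PATH-LATTICE POINT between the base configuration `U₀` and the target configuration `U₁`: the coordinates in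
`T` are taken from `U₁`, all others from `U₀` (`Finset.piecewise`). [folklore] -/
abbrev pathPt (U₁ U₀ : ι → X) (T : Finset ι) : ι → X := T.piecewise U₁ U₀

/-- THE MIXED SECOND DIFFERENCE of `h` at the path-lattice base `T` in the two coordinates `b, c`:
`h(T ∪ {b,c}) − h(T ∪ {c}) − h(T ∪ {b}) + h(T)`. [folklore] -/
def sqDiff (h : (ι → X) → ℝ) (U₁ U₀ : ι → X) (T : Finset ι) (b c : ι) : ℝ :=
  h (pathPt U₁ U₀ (insert b (insert c T))) - h (pathPt U₁ U₀ (insert c T)) - h (pathPt U₁ U₀ (insert b T))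
    + h (pathPt U₁ U₀ T)

/-- HYPOTHESIS SHAPE — THE PAIR BUDGET: along the path lattice between `U₀` and `U₁` every mixed second difference in
two distinct fresh coordinates `b, c ∉ T` is at most `M b c`.  Consumed only as a hypothesis; §2 produces it for loop
variables of iterated averages from `T4AvgDerivBound.LoopPairDerivBound` on fibre-convex domains. [folklore] -/
def SqBound (h : (ι → X) → ℝ) (U₁ U₀ : ι → X) (M : ι → ι → ℝ) : Prop :=
  ∀ (T : Finset ι) (b c : ι), b ∉ T → c ∉ T → b ≠ c → |sqDiff h U₁ U₀ T b c| ≤ M b c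

/-- The POINT × SET rectangle at base `T`: `h(T ∪ S ∪ {b}) − h(T ∪ S) − h(T ∪ {b}) + h(T)`. [folklore] -/
def rect₁ (h : (ι → X) → ℝ) (U₁ U₀ : ι → X) (T : Finset ι) (b : ι) (S : Finset ι) : ℝ :=
  h (pathPt U₁ U₀ (insert b (T ∪ S))) - h (pathPt U₁ U₀ (T ∪ S)) - h (pathPt U₁ U₀ (insert b T))
    + h (pathPt U₁ U₀ T)

/-- The SET × SET rectangle at base `∅`: `h(S ∪ X) − h(X) − h(S) + h(∅)`. [folklore] -/
def rect₀ (h : (ι → X) → ℝ) (U₁ U₀ : ι → X) (X S : Finset ι) : ℝ :=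
  h (pathPt U₁ U₀ (S ∪ X)) - h (pathPt U₁ U₀ X) - h (pathPt U₁ U₀ S) + h U₀

/-- The PURE SEPARABILITY REMAINDER of the coordinates `S` at base `∅`:
`h(S) − h(∅) − Σ_{b ∈ S} (h({b}) − h(∅))`. [folklore] -/
def sepRem₀ (h : (ι → X) → ℝ) (U₁ U₀ : ι → X) (S : Finset ι) : ℝ :=
  h (pathPt U₁ U₀ S) - h U₀ - ∑ b ∈ S, (h (pathPt U₁ U₀ {b}) - h U₀)

/-- THE SEPARABLE EXPANSION REMAINDER WITH EXTERIOR SHIFT: switch the «exterior» coordinates `X` AND the «fibre»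
coordinates `S` (target `h(S ∪ X)`), subtract the value with only the exterior switched (`h(X)`), and subtract the sum of
the ONE-COORDINATE increments of the fibre coordinates taken at the BASE configuration (`h({b}) − h(∅)`, no exterior
switched). [folklore] -/
def sepRem (h : (ι → X) → ℝ) (U₁ U₀ : ι → X) (X S : Finset ι) : ℝ :=
  h (pathPt U₁ U₀ (S ∪ X)) - h (pathPt U₁ U₀ X) - ∑ b ∈ S, (h (pathPt U₁ U₀ {b}) - h U₀)

variable {h : (ι → X) → ℝ} {U₁ U₀ : ι → X} {M : ι → ι → ℝ}

/-- The base point of the path lattice is `U₀`. [folklore] -/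
@[simp] theorem pathPt_empty (U₁ U₀ : ι → X) : pathPt U₁ U₀ ∅ = U₀ := Finset.piecewise_empty _ _

/-- The decomposition `sepRem = rect₀ + sepRem₀`. [folklore] -/
theorem sepRem_eq_rect₀_add_sepRem₀ (X S : Finset ι) :
    sepRem h U₁ U₀ X S = rect₀ h U₁ U₀ X S + sepRem₀ h U₁ U₀ S := by
  simp only [sepRem, rect₀, sepRem₀]; ring

/-- POINT × SET TELESCOPING: switching the coordinates of `S` one at a time, the point × set rectangle is a sum of
`|S|` squares, whence `|rect₁ T b S| ≤ Σ_{c ∈ S} M b c`. [folklore] -/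
theorem abs_rect₁_le (hM : SqBound h U₁ U₀ M) (T : Finset ι) (b : ι) :
    ∀ S : Finset ι, b ∉ T → b ∉ S → (∀ c ∈ S, c ∉ T) → |rect₁ h U₁ U₀ T b S| ≤ ∑ c ∈ S, M b c := by
  intro S
  induction S using Finset.induction_on with
  | empty =>
    intro _ _ _
    simp [rect₁]
  | insert c S hcS ih =>
    intro hbT hbS hST
    have hbc : b ≠ c := by rintro rfl; exact hbS (Finset.mem_insert_self _ _)
    have hbS' : b ∉ S := fun h' => hbS (Finset.mem_insert_of_mem h')
    have hcT : c ∉ T := hST c (Finset.mem_insert_self _ _)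
    have hST' : ∀ c' ∈ S, c' ∉ T := fun c' hc' => hST c' (Finset.mem_insert_of_mem hc')
    have key : rect₁ h U₁ U₀ T b (insert c S) = sqDiff h U₁ U₀ (T ∪ S) b c + rect₁ h U₁ U₀ T b S := by
      simp only [rect₁, sqDiff, Finset.union_insert]; ring
    rw [key, Finset.sum_insert hcS]
    have h1 := hM (T ∪ S) b c (by simp [hbT, hbS']) (by simp [hcT, hcS]) hbc
    exact (abs_add_le _ _).trans (add_le_add h1 (ih hbT hbS' hST'))

/-- SEPARABILITY TELESCOPING: `|sepRem₀ S| ≤ Σ_{b ∈ S} Σ_{c ∈ S} M b c` (the full double sum; for a product budget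
`M b c = K·d_b·d_c` this is `K·(Σ_b d_b)²`). [folklore] -/
theorem abs_sepRem₀_le (hM : SqBound h U₁ U₀ M) (hM0 : ∀ b c, 0 ≤ M b c) :
    ∀ S : Finset ι, |sepRem₀ h U₁ U₀ S| ≤ ∑ b ∈ S, ∑ c ∈ S, M b c := by
  intro S
  induction S using Finset.induction_on with
  | empty => simp [sepRem₀]
  | insert b S hbS ih =>
    have key : sepRem₀ h U₁ U₀ (insert b S) = rect₁ h U₁ U₀ ∅ b S + sepRem₀ h U₁ U₀ S := by
      simp only [sepRem₀, rect₁, Finset.empty_union, Finset.sum_insert hbS, pathPt_empty,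
        Finset.insert_empty]
      ring
    rw [key]
    have h1 := abs_rect₁_le hM ∅ b S (Finset.notMem_empty b) hbS (fun c _ => Finset.notMem_empty c)
    have h2 : ∑ c ∈ S, M b c + ∑ b' ∈ S, ∑ c ∈ S, M b' c ≤ ∑ b' ∈ insert b S, ∑ c ∈ insert b S, M b' c := by
      simp only [Finset.sum_insert hbS, Finset.sum_add_distrib]
      have h3 : 0 ≤ ∑ b' ∈ S, M b' b := Finset.sum_nonneg fun b' _ => hM0 b' b
      linarith [hM0 b b]
    exact ((abs_add_le _ _).trans (add_le_add h1 ih)).trans h2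

/-- EXTERIOR × FIBRE TELESCOPING: `|rect₀ X S| ≤ Σ_{b ∈ S} Σ_{c ∈ X} M b c` for disjoint `S`, `X`. [folklore] -/
theorem abs_rect₀_le (hM : SqBound h U₁ U₀ M) (X : Finset ι) :
    ∀ S : Finset ι, Disjoint S X → |rect₀ h U₁ U₀ X S| ≤ ∑ b ∈ S, ∑ c ∈ X, M b c := by
  intro S
  induction S using Finset.induction_on with
  | empty =>
    intro _
    simp [rect₀]
  | insert b S hbS ih =>
    intro hd
    have hbX : b ∉ X := Finset.disjoint_left.mp hd (Finset.mem_insert_self b S)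
    have hd' : Disjoint S X := Finset.disjoint_of_subset_left (Finset.subset_insert b S) hd
    have key : rect₀ h U₁ U₀ X (insert b S) = rect₁ h U₁ U₀ S b X + rect₀ h U₁ U₀ X S := by
      simp only [rect₀, rect₁, Finset.insert_union]; ring
    rw [key, Finset.sum_insert hbS]
    have h1 := abs_rect₁_le hM S b X hbS hbX (fun c hc hcS => Finset.disjoint_left.mp hd' hcS hc)
    exact (abs_add_le _ _).trans (add_le_add h1 (ih hd'))

/-- **THE SEPARABLE EXPANSION** (abstract form).  A function whose mixed second differences along the path lattice
between `U₀` and `U₁` obey the pair budget `M ≥ 0` is, after switching the exterior coordinates `X`, ADDITIVELY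
SEPARABLE in the fibre coordinates `S` up to `Σ_{b∈S}Σ_{c∈X} M b c` (exterior × fibre pairs: the exterior dependence of
the one-coordinate increments) `+ Σ_{b∈S}Σ_{c∈S} M b c` (fibre × fibre pairs). [folklore] -/
theorem abs_sepRem_le (hM : SqBound h U₁ U₀ M) (hM0 : ∀ b c, 0 ≤ M b c) (X S : Finset ι) (hd : Disjoint S X) :
    |sepRem h U₁ U₀ X S| ≤ ∑ b ∈ S, ∑ c ∈ X, M b c + ∑ b ∈ S, ∑ c ∈ S, M b c := by
  rw [sepRem_eq_rect₀_add_sepRem₀]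
  exact (abs_add_le _ _).trans (add_le_add (abs_rect₀_le hM X S hd) (abs_sepRem₀_le hM hM0 S))

/-- EXACTNESS: with the zero budget (all mixed second differences vanish along the path lattice — e.g. an additively
separable `h`) the expansion is exact. [folklore] -/
theorem sepRem_eq_zero_of_sqBound_zero (hM : SqBound h U₁ U₀ fun _ _ => 0) (X S : Finset ι) (hd : Disjoint S X) :
    sepRem h U₁ U₀ X S = 0 := by
  have := abs_sepRem_le hM (fun _ _ => le_rfl) X S hd
  simp only [Finset.sum_const_zero, add_zero] at this
  exact abs_eq_zero.mp (le_antisymm this (abs_nonneg _))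

/-- NON-VACUITY of the shape: a bounded function, `|h| ≤ B`, obeys the pair budget `4B`. [folklore] -/
theorem sqBound_of_abs_le {B : ℝ} (hB : ∀ U, |h U| ≤ B) : SqBound h U₁ U₀ fun _ _ => 4 * B := by
  intro T b c _ _ _
  simp only [sqDiff]
  have e1 := hB (pathPt U₁ U₀ (insert b (insert c T)))
  have e2 := hB (pathPt U₁ U₀ (insert c T))
  have e3 := hB (pathPt U₁ U₀ (insert b T))
  have e4 := hB (pathPt U₁ U₀ T)
  rw [abs_le] at e1 e2 e3 e4 ⊢
  constructor <;> linarith [e1.1, e1.2, e2.1, e2.2, e3.1, e3.2, e4.1, e4.2]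

/-- HYPOTHESIS SHAPE — THE SINGLE-COORDINATE BUDGET along the path lattice: switching one fresh coordinate `b ∉ T`
moves `h` by at most `N b`.  Consumed only as a hypothesis; §2 produces it for loop variables of iterated averages from
`T4AvgDerivBound.LoopDerivBound`. [folklore] -/
def FdBound (h : (ι → X) → ℝ) (U₁ U₀ : ι → X) (N : ι → ℝ) : Prop :=
  ∀ (T : Finset ι) (b : ι), b ∉ T → |h (pathPt U₁ U₀ (insert b T)) - h (pathPt U₁ U₀ T)| ≤ N b

/-- Monotonicity of the pair budget. [folklore] -/
theorem SqBound.mono {M' : ι → ι → ℝ} (hM : SqBound h U₁ U₀ M) (hle : ∀ b c, M b c ≤ M' b c) :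
    SqBound h U₁ U₀ M' :=
  fun T b c hb hc hbc => (hM T b c hb hc hbc).trans (hle b c)

/-- Monotonicity of the single-coordinate budget. [folklore] -/
theorem FdBound.mono {N N' : ι → ℝ} (hN : FdBound h U₁ U₀ N) (hle : ∀ b, N b ≤ N' b) : FdBound h U₁ U₀ N' :=
  fun T b hb => (hN T b hb).trans (hle b)

/-- THE DISCRETE LEIBNIZ RULE for the mixed second difference of a product: second difference × value, value ×
second difference, and the two cross products of first differences. [folklore] -/
theorem sqDiff_mul (f g : (ι → X) → ℝ) (U₁ U₀ : ι → X) (T : Finset ι) (b c : ι) :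
    sqDiff (fun U => f U * g U) U₁ U₀ T b c
      = sqDiff f U₁ U₀ T b c * g (pathPt U₁ U₀ (insert b (insert c T)))
        + f (pathPt U₁ U₀ (insert c T)) * sqDiff g U₁ U₀ T b c
        + (f (pathPt U₁ U₀ (insert b T)) - f (pathPt U₁ U₀ T))
            * (g (pathPt U₁ U₀ (insert b (insert c T))) - g (pathPt U₁ U₀ (insert b T)))
        + (f (pathPt U₁ U₀ (insert c T)) - f (pathPt U₁ U₀ T))
            * (g (pathPt U₁ U₀ (insert b T)) - g (pathPt U₁ U₀ T)) := by
  simp only [sqDiff]; ring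

/-- PRODUCT RULE FOR THE SINGLE-COORDINATE BUDGET (bounded factors). [folklore] -/
theorem fdBound_mul {f g : (ι → X) → ℝ} {Nf Ng : ι → ℝ} {Bf Bg : ℝ} (hfB : ∀ U, |f U| ≤ Bf)
    (hgB : ∀ U, |g U| ≤ Bg) (hfN : FdBound f U₁ U₀ Nf) (hgN : FdBound g U₁ U₀ Ng) :
    FdBound (fun U => f U * g U) U₁ U₀ fun b => Nf b * Bg + Bf * Ng b := by
  intro T b hbT
  have e : f (pathPt U₁ U₀ (insert b T)) * g (pathPt U₁ U₀ (insert b T)) - f (pathPt U₁ U₀ T) * g (pathPt U₁ U₀ T)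
      = (f (pathPt U₁ U₀ (insert b T)) - f (pathPt U₁ U₀ T)) * g (pathPt U₁ U₀ (insert b T))
        + f (pathPt U₁ U₀ T) * (g (pathPt U₁ U₀ (insert b T)) - g (pathPt U₁ U₀ T)) := by ring
  show |f _ * g _ - f _ * g _| ≤ _
  rw [e]
  refine (abs_add_le _ _).trans (add_le_add ?_ ?_)
  · rw [abs_mul]
    exact mul_le_mul (hfN T b hbT) (hgB _) (abs_nonneg _) ((abs_nonneg _).trans (hfN T b hbT))
  · rw [abs_mul]
    exact mul_le_mul (hfB _) (hgN T b hbT) (abs_nonneg _) ((abs_nonneg _).trans (hfB U₀))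

/-- PRODUCT RULE FOR THE PAIR BUDGET (bounded factors with single-coordinate budgets): the pair budget of `f·g` is
`M_f·B_g + B_f·M_g + N_f(b)·N_g(c) + N_f(c)·N_g(b)`. [folklore] -/
theorem sqBound_mul {f g : (ι → X) → ℝ} {Mf Mg : ι → ι → ℝ} {Nf Ng : ι → ℝ} {Bf Bg : ℝ}
    (hfB : ∀ U, |f U| ≤ Bf) (hgB : ∀ U, |g U| ≤ Bg) (hfM : SqBound f U₁ U₀ Mf) (hgM : SqBound g U₁ U₀ Mg)
    (hfN : FdBound f U₁ U₀ Nf) (hgN : FdBound g U₁ U₀ Ng) :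
    SqBound (fun U => f U * g U) U₁ U₀ fun b c => Mf b c * Bg + Bf * Mg b c + Nf b * Ng c + Nf c * Ng b := by
  intro T b c hbT hcT hbc
  rw [sqDiff_mul]
  show _ ≤ Mf b c * Bg + Bf * Mg b c + Nf b * Ng c + Nf c * Ng b
  have hcb : c ∉ insert b T := by simp [hbc.symm, hcT]
  have h1 : |sqDiff f U₁ U₀ T b c * g (pathPt U₁ U₀ (insert b (insert c T)))| ≤ Mf b c * Bg := by
    rw [abs_mul]
    exact mul_le_mul (hfM T b c hbT hcT hbc) (hgB _) (abs_nonneg _)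
      ((abs_nonneg _).trans (hfM T b c hbT hcT hbc))
  have h2 : |f (pathPt U₁ U₀ (insert c T)) * sqDiff g U₁ U₀ T b c| ≤ Bf * Mg b c := by
    rw [abs_mul]
    exact mul_le_mul (hfB _) (hgM T b c hbT hcT hbc) (abs_nonneg _) ((abs_nonneg _).trans (hfB U₀))
  have h3 : |(f (pathPt U₁ U₀ (insert b T)) - f (pathPt U₁ U₀ T))
        * (g (pathPt U₁ U₀ (insert b (insert c T))) - g (pathPt U₁ U₀ (insert b T)))| ≤ Nf b * Ng c := by
    rw [abs_mul, Finset.insert_comm]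
    exact mul_le_mul (hfN T b hbT) (hgN (insert b T) c hcb) (abs_nonneg _) ((abs_nonneg _).trans (hfN T b hbT))
  have h4 : |(f (pathPt U₁ U₀ (insert c T)) - f (pathPt U₁ U₀ T))
        * (g (pathPt U₁ U₀ (insert b T)) - g (pathPt U₁ U₀ T))| ≤ Nf c * Ng b := by
    rw [abs_mul]
    exact mul_le_mul (hfN T c hcT) (hgN T b hbT) (abs_nonneg _) ((abs_nonneg _).trans (hfN T c hcT))
  exact ((abs_add_le _ _).trans (add_le_add ((abs_add_le _ _).trans
    (add_le_add (abs_add_le _ _) le_rfl)) le_rfl)).trans (add_le_add (add_le_add (add_le_add h1 h2) h3) h4)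

/-- **THE BUDGETS OF A FINITE PRODUCT** of factors bounded by `1` with PRODUCT-FORM budgets on a common size profile
`d ≥ 0` (pair budget `μ_a·d_b·d_c`, single-coordinate budget `ν_a·d_b`): the product is bounded by `1`, has
single-coordinate budget `(Σ_a ν_a)·d_b` and pair budget `(Σ_a μ_a + (Σ_a ν_a)²)·d_b·d_c` (the cross terms
`2Σ_{a<a′} ν_a ν_{a′} ≤ (Σ ν)²`). [folklore] -/
theorem listProd_budget {κ : Type*} (f : κ → (ι → X) → ℝ) (μ ν : κ → ℝ) (d : ι → ℝ) (hd : ∀ b, 0 ≤ d b) :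
    ∀ l : List κ, (∀ a ∈ l, (∀ U, |f a U| ≤ 1) ∧ 0 ≤ μ a ∧ 0 ≤ ν a ∧
        SqBound (f a) U₁ U₀ (fun b c => μ a * d b * d c) ∧ FdBound (f a) U₁ U₀ (fun b => ν a * d b)) →
      (∀ U, |(l.map fun a => f a U).prod| ≤ 1) ∧
        FdBound (fun U => (l.map fun a => f a U).prod) U₁ U₀ (fun b => (l.map ν).sum * d b) ∧
        SqBound (fun U => (l.map fun a => f a U).prod) U₁ U₀
          (fun b c => ((l.map μ).sum + (l.map ν).sum ^ 2) * d b * d c)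
  | [], _ => by
    refine ⟨fun U => by simp, fun T b _ => by simp, fun T b c _ _ _ => by simp [sqDiff]⟩
  | a :: l, hal => by
    obtain ⟨hB, hμ, hν, hM, hN⟩ := hal a (List.mem_cons.2 (Or.inl rfl))
    have hal' : ∀ a' ∈ l, (∀ U, |f a' U| ≤ 1) ∧ 0 ≤ μ a' ∧ 0 ≤ ν a' ∧
        SqBound (f a') U₁ U₀ (fun b c => μ a' * d b * d c) ∧ FdBound (f a') U₁ U₀ (fun b => ν a' * d b) :=
      fun a' ha' => hal a' (List.mem_cons.2 (Or.inr ha'))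
    obtain ⟨iB, iN, iM⟩ := listProd_budget f μ ν d hd l hal'
    refine ⟨?_, ?_, ?_⟩
    · intro U
      simp only [List.map_cons, List.prod_cons, abs_mul]
      exact mul_le_one₀ (hB U) (abs_nonneg _) (iB U)
    · have h := fdBound_mul (Bf := 1) (Bg := 1) hB iB hN iN
      simp only [List.map_cons, List.prod_cons, List.sum_cons]
      exact h.mono fun b => le_of_eq (by ring)
    · have h := sqBound_mul (Bf := 1) (Bg := 1) hB iB hM iM hN iN
      simp only [List.map_cons, List.prod_cons, List.sum_cons]
      refine h.mono fun b c => ?_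
      have e : ((μ a + (l.map μ).sum) + (ν a + (l.map ν).sum) ^ 2) * d b * d c
          = (μ a * d b * d c * 1 + 1 * (((l.map μ).sum + (l.map ν).sum ^ 2) * d b * d c)
              + ν a * d b * ((l.map ν).sum * d c) + ν a * d c * ((l.map ν).sum * d b))
            + ν a ^ 2 * (d b * d c) := by ring
      rw [e]
      have := mul_nonneg (sq_nonneg (ν a)) (mul_nonneg (hd b) (hd c))
      linarith

omit [DecidableEq ι] in
/-- Rearrangement of the double sums of a PRODUCT budget `M b c = K·d_b·d_c·t`. [folklore] -/
theorem sum_sum_prodBudget (μ : ℝ) (d : ι → ℝ) (S X : Finset ι) :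
    ∑ b ∈ S, ∑ c ∈ X, μ * d b * d c = μ * ((∑ b ∈ S, d b) * ∑ c ∈ X, d c) := by
  rw [Finset.sum_mul_sum, Finset.mul_sum]
  refine Finset.sum_congr rfl fun b _ => ?_
  rw [Finset.mul_sum]
  refine Finset.sum_congr rfl fun c _ => ?_
  ring

end Abstract

/-! ## §2 The fibre of a gauge field: the dictionary `updateFinset` ↔ path lattice, and the pair budget of a loop
variable of an iterated average from `LoopPairDerivBound` on a fibre-convex domain -/

section Fibre

open Literature.MathematicalPhysics.QuantumFieldTheory.Balaban1983to89.T4Continuum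
open Literature.MathematicalPhysics.QuantumFieldTheory.Balaban1983to89.T4AvgSensitivity
open Literature.MathematicalPhysics.QuantumFieldTheory.Balaban1983to89.T4AvgDerivBound

variable {P : Params} {G : Type*}

/-- THE ONE-BOND INCREMENT of a weight `g` along the fibre `s` AT THE REFERENCE POINT (exterior `V₀`, fibre point
`y₀`): `g(V₀ ← (y₀; b ← y_b)) − g(V₀ ← y₀)` — a function of the single fibre variable `y_b`. [folklore] -/
def bondIncr {k : ℕ} [DecidableEq (PBond P k)] (s : Finset (PBond P k)) (g : GaugeField P k G → ℝ)
    (V₀ : GaugeField P k G) (y₀ y : s → G) (b : s) : ℝ :=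
  g (updateFinset V₀ s (Function.update y₀ b (y b))) - g (updateFinset V₀ s y₀)

/-- THE FIBRE SEPARABILITY REMAINDER of `g` through the exterior `V` at the fibre point `y`, relative to the
reference point `(V₀, y₀)`: `g(V ← y) − g(V ← y₀) − Σ_{b ∈ s} bondIncr b`. [folklore] -/
def fibreSepRem {k : ℕ} [DecidableEq (PBond P k)] (s : Finset (PBond P k)) (g : GaugeField P k G → ℝ)
    (V₀ : GaugeField P k G) (y₀ : s → G) (V : GaugeField P k G) (y : s → G) : ℝ :=
  g (updateFinset V s y) - g (updateFinset V s y₀) - ∑ b : s, bondIncr s g V₀ y₀ y b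

variable {k : ℕ} [DecidableEq (PBond P k)]

/-- Dictionary (i): switching every coordinate gives the target `V ← y`. [folklore] -/
theorem pathPt_union_compl (s : Finset (PBond P k)) (V V₀ : GaugeField P k G) (y y₀ : s → G) :
    pathPt (updateFinset V s y) (updateFinset V₀ s y₀) (s ∪ sᶜ) = updateFinset V s y := by
  rw [Finset.union_compl]
  exact Finset.piecewise_univ _ _

/-- Dictionary (ii): switching only the exterior coordinates gives `V ← y₀`. [folklore] -/
theorem pathPt_compl (s : Finset (PBond P k)) (V V₀ : GaugeField P k G) (y y₀ : s → G) :
    pathPt (updateFinset V s y) (updateFinset V₀ s y₀) sᶜ = updateFinset V s y₀ := by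
  funext c
  by_cases hc : c ∈ s
  · have : c ∉ sᶜ := by simp [hc]
    simp [pathPt, Finset.piecewise, this, updateFinset, hc]
  · have : c ∈ sᶜ := by simp [hc]
    simp [pathPt, Finset.piecewise, this, updateFinset, hc]

/-- Dictionary (iii): switching the single fibre coordinate `b` gives `V₀ ← (y₀; b ← y_b)`. [folklore] -/
theorem pathPt_singleton (s : Finset (PBond P k)) (V V₀ : GaugeField P k G) (y y₀ : s → G) (b : s) :
    pathPt (updateFinset V s y) (updateFinset V₀ s y₀) {(b : PBond P k)}
      = updateFinset V₀ s (Function.update y₀ b (y b)) := by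
  funext c
  rw [pathPt, Finset.piecewise_singleton]
  by_cases hcb : c = (b : PBond P k)
  · subst hcb
    simp [updateFinset, Function.update_self]
  · rw [Function.update_of_ne hcb]
    by_cases hc : c ∈ s
    · have hne : (⟨c, hc⟩ : s) ≠ b := fun h' => hcb (congrArg Subtype.val h')
      simp [updateFinset, hc, Function.update_of_ne hne]
    · simp [updateFinset, hc]

/-- Dictionary (iv): the fibre separability remainder IS the abstract `sepRem` with exterior set `sᶜ` and fibre set
`s`, base `V₀ ← y₀`, target `V ← y`. [folklore] -/
theorem fibreSepRem_eq_sepRem (s : Finset (PBond P k)) (g : GaugeField P k G → ℝ) (V V₀ : GaugeField P k G)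
    (y y₀ : s → G) :
    fibreSepRem s g V₀ y₀ V y = sepRem g (updateFinset V s y) (updateFinset V₀ s y₀) sᶜ s := by
  simp only [fibreSepRem, sepRem, pathPt_union_compl, pathPt_compl, bondIncr]
  rw [← Finset.sum_coe_sort s]
  simp only [pathPt_singleton]

/-- **THE FIBRE SEPARABLE EXPANSION** for any weight with a pair budget along the path lattice between the reference
point `V₀ ← y₀` and the target `V ← y`. [folklore] -/
theorem abs_fibreSepRem_le (s : Finset (PBond P k)) {g : GaugeField P k G → ℝ} {V V₀ : GaugeField P k G}
    {y y₀ : s → G} {M : PBond P k → PBond P k → ℝ}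
    (hM : SqBound g (updateFinset V s y) (updateFinset V₀ s y₀) M) (hM0 : ∀ b c, 0 ≤ M b c) :
    |fibreSepRem s g V₀ y₀ V y| ≤ ∑ b ∈ s, ∑ c ∈ sᶜ, M b c + ∑ b ∈ s, ∑ c ∈ s, M b c := by
  rw [fibreSepRem_eq_sepRem]
  exact abs_sepRem_le hM hM0 sᶜ s disjoint_compl_right

/-- **THE FIBRE SEPARABLE EXPANSION UNDER A PRODUCT-FORM PAIR BUDGET** `μ·bdist_b·bdist_c` (`μ ≥ 0`) along the
path lattice between `V₀ ← y₀` and `V ← y`: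
`|fibreSepRem| ≤ μ · (Σ_{b∈s} bdist(y₀ b, y b)) · tv(V₀←y₀, V←y)` — the FIBRE variation times the TOTAL variation
(fibre × fibre pairs and exterior × fibre pairs; `Finset.sum_compl_add_sum`). [folklore] -/
theorem abs_fibreSepRem_le_of_prodBudget [GaugeGroup G] (s : Finset (PBond P k)) {g : GaugeField P k G → ℝ}
    {V V₀ : GaugeField P k G} {y y₀ : s → G} {μ : ℝ}
    (hM : SqBound g (updateFinset V s y) (updateFinset V₀ s y₀) fun b c =>
      μ * bdist (updateFinset V₀ s y₀ b) (updateFinset V s y b)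
        * bdist (updateFinset V₀ s y₀ c) (updateFinset V s y c))
    (hμ : 0 ≤ μ) :
    |fibreSepRem s g V₀ y₀ V y|
      ≤ μ * (∑ b : s, bdist (y₀ b) (y b)) * tv (updateFinset V₀ s y₀) (updateFinset V s y) := by
  set U₀ := updateFinset V₀ s y₀ with hU₀
  set U₁ := updateFinset V s y with hU₁
  have hM0 : ∀ b c : PBond P k, 0 ≤ μ * bdist (U₀ b) (U₁ b) * bdist (U₀ c) (U₁ c) := fun b c => by
    have := bdist_nonneg (U₀ b) (U₁ b); have := bdist_nonneg (U₀ c) (U₁ c); positivity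
  have h := abs_fibreSepRem_le s hM hM0
  rw [sum_sum_prodBudget, sum_sum_prodBudget, ← mul_add, ← mul_add, Finset.sum_compl_add_sum] at h
  have hfib : ∑ b ∈ s, bdist (U₀ b) (U₁ b) = ∑ b : s, bdist (y₀ b) (y b) := by
    rw [← Finset.sum_coe_sort s]
    refine Finset.sum_congr rfl fun b _ => ?_
    simp [hU₀, hU₁, updateFinset, b.2]
  rw [hfib] at h
  calc |fibreSepRem s g V₀ y₀ V y|
      ≤ μ * ((∑ b : s, bdist (y₀ b) (y b)) * ∑ c, bdist (U₀ c) (U₁ c)) := h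
    _ = _ := by rw [tv]; ring

variable [GaugeGroup G]

omit [GaugeGroup G] in
/-- Path-lattice points between two configurations of a FIBRE-CONVEX domain stay in the domain. [folklore] -/
theorem pathPt_mem {dom : ∀ j, Set (GaugeField P j G)} (hconv : FibreConvex dom) {U₀ U₁ : PBond P k → G}
    (h₀ : U₀ ∈ dom k) (h₁ : U₁ ∈ dom k) (T : Finset (PBond P k)) : pathPt U₁ U₀ T ∈ dom k :=
  hconv k U₀ U₁ _ h₀ h₁ fun b => by
    by_cases hb : b ∈ T
    · exact Or.inr (Finset.piecewise_eq_of_mem _ _ _ hb)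
    · exact Or.inl (Finset.piecewise_eq_of_notMem _ _ _ hb)

/-- **THE PAIR BUDGET OF A LOOP VARIABLE OF AN ITERATED AVERAGE** from the row's mixed second-difference shape:
under `LoopPairDerivBound av dom C₂ θ₂` on a fibre-convex domain containing `U₀` and `U₁`, the function
`U ↦ W_C(avgⁿ U)` obeys `SqBound` with the product-form budget `M b c = (C₂·|w|·θ₂ⁿ)·bdist(U₀ b, U₁ b)·bdist(U₀ c, U₁ c)`.
[folklore] -/
theorem sqBound_loop {av : ∀ j, Averaging P j G} {dom : ∀ j, Set (GaugeField P j G)} {C₂ θ₂ : ℝ}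
    (hpair : LoopPairDerivBound av dom C₂ θ₂) (hconv : FibreConvex dom) {n : ℕ} (hn : k + n ≤ P.m + P.K)
    {x : Site P (k + n)} {w : List (Letter P.d)} (hw : walkEnd x w = x) {U₀ U₁ : PBond P k → G}
    (h₀ : U₀ ∈ dom k) (h₁ : U₁ ∈ dom k) :
    SqBound (fun U => loopAt (iterFrom av k n U) (walk x w)) U₁ U₀
      fun b c => C₂ * (w.length : ℝ) * θ₂ ^ n * bdist (U₀ b) (U₁ b) * bdist (U₀ c) (U₁ c) := by
  intro T b c hbT hcT hbc
  have hsq := hpair k n hn x w hw b c hbc (pathPt U₁ U₀ T) (pathPt U₁ U₀ (insert b T))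
    (pathPt U₁ U₀ (insert c T)) (pathPt U₁ U₀ (insert b (insert c T))) (pathPt_mem hconv h₀ h₁ _)
    (pathPt_mem hconv h₀ h₁ _) (pathPt_mem hconv h₀ h₁ _) (pathPt_mem hconv h₀ h₁ _)
    (fun d hd => Finset.piecewise_insert_of_ne _ _ _ hd) (fun d hd => Finset.piecewise_insert_of_ne _ _ _ hd)
    (fun d hd => Finset.piecewise_insert_of_ne _ _ _ hd)
    ((Finset.piecewise_eq_of_mem _ _ _ (Finset.mem_insert_self _ _)).trans
      (Finset.piecewise_eq_of_mem _ _ _ (Finset.mem_insert_self _ _)).symm)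
  have eb0 : pathPt U₁ U₀ T b = U₀ b := Finset.piecewise_eq_of_notMem _ _ _ hbT
  have ec0 : pathPt U₁ U₀ T c = U₀ c := Finset.piecewise_eq_of_notMem _ _ _ hcT
  have eb1 : pathPt U₁ U₀ (insert b T) b = U₁ b := Finset.piecewise_eq_of_mem _ _ _ (Finset.mem_insert_self _ _)
  have ec1 : pathPt U₁ U₀ (insert c T) c = U₁ c := Finset.piecewise_eq_of_mem _ _ _ (Finset.mem_insert_self _ _)
  have e : sqDiff (fun U => loopAt (iterFrom av k n U) (walk x w)) U₁ U₀ T b c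
      = loopAt (iterFrom av k n (pathPt U₁ U₀ (insert b (insert c T)))) (walk x w)
        - loopAt (iterFrom av k n (pathPt U₁ U₀ (insert b T))) (walk x w)
        - loopAt (iterFrom av k n (pathPt U₁ U₀ (insert c T))) (walk x w)
        + loopAt (iterFrom av k n (pathPt U₁ U₀ T)) (walk x w) := by
    simp only [sqDiff]; ring
  have ebd : C₂ * (w.length : ℝ) * bdist (pathPt U₁ U₀ T b) (pathPt U₁ U₀ (insert b T) b)
        * bdist (pathPt U₁ U₀ T c) (pathPt U₁ U₀ (insert c T) c) * θ₂ ^ n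
      = C₂ * (w.length : ℝ) * θ₂ ^ n * bdist (U₀ b) (U₁ b) * bdist (U₀ c) (U₁ c) := by
    simp only [eb0, ec0, eb1, ec1]; ring
  exact (congrArg abs e).trans_le (hsq.trans_eq ebd)

/-- **THE FIBRE SEPARABLE EXPANSION OF A LOOP VARIABLE OF AN ITERATED AVERAGE.**  Under `LoopPairDerivBound av dom
C₂ θ₂` (`C₂, θ₂ ≥ 0`) on a fibre-convex domain containing the reference configuration `V₀ ← y₀` and the target
`V ← y`:
`|W(avgⁿ(V←y)) − W(avgⁿ(V←y₀)) − Σ_{b∈s} [W(avgⁿ(V₀←(y₀;b←y_b))) − W(avgⁿ(V₀←y₀))]|`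
`≤ C₂·|w|·θ₂ⁿ · (Σ_{b∈s} bdist(y₀ b, y b)) · tv(V₀←y₀, V←y)`. [folklore] -/
theorem abs_fibreSepRem_loop_le {av : ∀ j, Averaging P j G} {dom : ∀ j, Set (GaugeField P j G)} {C₂ θ₂ : ℝ}
    (hpair : LoopPairDerivBound av dom C₂ θ₂) (hconv : FibreConvex dom) (hC₂ : 0 ≤ C₂) (hθ₂ : 0 ≤ θ₂) {n : ℕ}
    (hn : k + n ≤ P.m + P.K) {x : Site P (k + n)} {w : List (Letter P.d)} (hw : walkEnd x w = x)
    (s : Finset (PBond P k)) {V V₀ : GaugeField P k G} {y y₀ : s → G} (h₀ : updateFinset V₀ s y₀ ∈ dom k)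
    (h₁ : updateFinset V s y ∈ dom k) :
    |fibreSepRem s (fun U => loopAt (iterFrom av k n U) (walk x w)) V₀ y₀ V y|
      ≤ C₂ * (w.length : ℝ) * θ₂ ^ n * (∑ b : s, bdist (y₀ b) (y b))
          * tv (updateFinset V₀ s y₀) (updateFinset V s y) :=
  abs_fibreSepRem_le_of_prodBudget s (sqBound_loop hpair hconv hn hw h₀ h₁) (by positivity)

/-- THE SINGLE-COORDINATE BUDGET OF A LOOP VARIABLE OF AN ITERATED AVERAGE from the row's first-difference shape
`LoopDerivBound av dom C₁ θ₁`: `N b = (C₁·|w|·θ₁ⁿ)·bdist(U₀ b, U₁ b)` along the path lattice of a fibre-convex domain.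
[folklore] -/
theorem fdBound_loop {av : ∀ j, Averaging P j G} {dom : ∀ j, Set (GaugeField P j G)} {C₁ θ₁ : ℝ}
    (hder : LoopDerivBound av dom C₁ θ₁) (hconv : FibreConvex dom) {n : ℕ} (hn : k + n ≤ P.m + P.K)
    {x : Site P (k + n)} {w : List (Letter P.d)} (hw : walkEnd x w = x) {U₀ U₁ : PBond P k → G}
    (h₀ : U₀ ∈ dom k) (h₁ : U₁ ∈ dom k) :
    FdBound (fun U => loopAt (iterFrom av k n U) (walk x w)) U₁ U₀
      fun b => C₁ * (w.length : ℝ) * θ₁ ^ n * bdist (U₀ b) (U₁ b) := by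
  intro T b hbT
  have h := hder k n hn x w hw b (pathPt U₁ U₀ (insert b T)) (pathPt U₁ U₀ T) (pathPt_mem hconv h₀ h₁ _)
    (pathPt_mem hconv h₀ h₁ _) (fun c hc => Finset.piecewise_insert_of_ne _ _ _ hc)
  have eb1 : pathPt U₁ U₀ (insert b T) b = U₁ b := Finset.piecewise_eq_of_mem _ _ _ (Finset.mem_insert_self _ _)
  have eb0 : pathPt U₁ U₀ T b = U₀ b := Finset.piecewise_eq_of_notMem _ _ _ hbT
  have ebd : C₁ * (w.length : ℝ) * bdist (pathPt U₁ U₀ (insert b T) b) (pathPt U₁ U₀ T b) * θ₁ ^ n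
      = C₁ * (w.length : ℝ) * θ₁ ^ n * bdist (U₀ b) (U₁ b) := by
    rw [eb1, eb0, bdist_comm]; ring
  exact h.trans_eq ebd

/-- **THE BUDGETS OF A PRODUCT OF LOOP VARIABLES OF AN ITERATED AVERAGE** (the cell's loop PRODUCTS, e.g. the weight
`prodLoop` of `T4ObservableTelescopeTwoRun` pulled back by `pullback av k n = (· ∘ iterFrom av k n)`): for a list of
closed walks `(xᵢ, wᵢ)` at level `k + n`, under both row shapes on a fibre-convex domain (regular gauge group, so that
`|W| ≤ 1`), the product `U ↦ ∏ᵢ W_{Cᵢ}(avgⁿ U)` is bounded by `1`, has single-coordinate budget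
`(Σᵢ C₁|wᵢ|θ₁ⁿ)·bdist_b` and pair budget `(Σᵢ C₂|wᵢ|θ₂ⁿ + (Σᵢ C₁|wᵢ|θ₁ⁿ)²)·bdist_b·bdist_c` — pair rate
`max(θ₂, θ₁²)ⁿ`. [folklore] -/
theorem loopProd_budget [MeasurableSpace G] [RegularGaugeGroup G] {av : ∀ j, Averaging P j G}
    {dom : ∀ j, Set (GaugeField P j G)} {C₁ θ₁ C₂ θ₂ : ℝ} (hder : LoopDerivBound av dom C₁ θ₁)
    (hpair : LoopPairDerivBound av dom C₂ θ₂) (hconv : FibreConvex dom) (hC₁ : 0 ≤ C₁) (hθ₁ : 0 ≤ θ₁)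
    (hC₂ : 0 ≤ C₂) (hθ₂ : 0 ≤ θ₂) {n : ℕ} (hn : k + n ≤ P.m + P.K)
    (ws : List (Site P (k + n) × List (Letter P.d))) (hws : ∀ xw ∈ ws, walkEnd xw.1 xw.2 = xw.1)
    {U₀ U₁ : PBond P k → G} (h₀ : U₀ ∈ dom k) (h₁ : U₁ ∈ dom k) :
    (∀ U, |(ws.map fun xw => loopAt (iterFrom av k n U) (walk xw.1 xw.2)).prod| ≤ 1) ∧
      FdBound (fun U => (ws.map fun xw => loopAt (iterFrom av k n U) (walk xw.1 xw.2)).prod) U₁ U₀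
        (fun b => (ws.map fun xw => C₁ * (xw.2.length : ℝ) * θ₁ ^ n).sum * bdist (U₀ b) (U₁ b)) ∧
      SqBound (fun U => (ws.map fun xw => loopAt (iterFrom av k n U) (walk xw.1 xw.2)).prod) U₁ U₀
        (fun b c => ((ws.map fun xw => C₂ * (xw.2.length : ℝ) * θ₂ ^ n).sum
            + (ws.map fun xw => C₁ * (xw.2.length : ℝ) * θ₁ ^ n).sum ^ 2)
          * bdist (U₀ b) (U₁ b) * bdist (U₀ c) (U₁ c)) := by
  refine listProd_budget (fun xw U => loopAt (iterFrom av k n U) (walk xw.1 xw.2))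
    (fun xw => C₂ * (xw.2.length : ℝ) * θ₂ ^ n) (fun xw => C₁ * (xw.2.length : ℝ) * θ₁ ^ n)
    (fun b => bdist (U₀ b) (U₁ b)) (fun b => bdist_nonneg _ _) ws fun xw hxw => ⟨?_, ?_, ?_, ?_, ?_⟩
  · exact fun U => abs_loopAt_le_one _ _
  · show 0 ≤ C₂ * (xw.2.length : ℝ) * θ₂ ^ n
    positivity
  · show 0 ≤ C₁ * (xw.2.length : ℝ) * θ₁ ^ n
    positivity
  · exact sqBound_loop hpair hconv hn (hws xw hxw) h₀ h₁
  · exact fdBound_loop hder hconv hn (hws xw hxw) h₀ h₁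

/-- **THE FIBRE SEPARABLE EXPANSION OF A PRODUCT OF LOOP VARIABLES OF AN ITERATED AVERAGE**:
`|fibreSepRem| ≤ (Σᵢ C₂|wᵢ|θ₂ⁿ + (Σᵢ C₁|wᵢ|θ₁ⁿ)²) · (Σ_{b∈s} bdist(y₀ b, y b)) · tv(V₀←y₀, V←y)`. [folklore] -/
theorem abs_fibreSepRem_loopProd_le [MeasurableSpace G] [RegularGaugeGroup G] {av : ∀ j, Averaging P j G}
    {dom : ∀ j, Set (GaugeField P j G)} {C₁ θ₁ C₂ θ₂ : ℝ} (hder : LoopDerivBound av dom C₁ θ₁)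
    (hpair : LoopPairDerivBound av dom C₂ θ₂) (hconv : FibreConvex dom) (hC₁ : 0 ≤ C₁) (hθ₁ : 0 ≤ θ₁)
    (hC₂ : 0 ≤ C₂) (hθ₂ : 0 ≤ θ₂) {n : ℕ} (hn : k + n ≤ P.m + P.K)
    (ws : List (Site P (k + n) × List (Letter P.d))) (hws : ∀ xw ∈ ws, walkEnd xw.1 xw.2 = xw.1)
    (s : Finset (PBond P k)) {V V₀ : GaugeField P k G} {y y₀ : s → G} (h₀ : updateFinset V₀ s y₀ ∈ dom k)
    (h₁ : updateFinset V s y ∈ dom k) :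
    |fibreSepRem s (fun U => (ws.map fun xw => loopAt (iterFrom av k n U) (walk xw.1 xw.2)).prod) V₀ y₀ V y|
      ≤ ((ws.map fun xw => C₂ * (xw.2.length : ℝ) * θ₂ ^ n).sum
            + (ws.map fun xw => C₁ * (xw.2.length : ℝ) * θ₁ ^ n).sum ^ 2)
          * (∑ b : s, bdist (y₀ b) (y b)) * tv (updateFinset V₀ s y₀) (updateFinset V s y) := by
  refine abs_fibreSepRem_le_of_prodBudget s
    (loopProd_budget hder hpair hconv hC₁ hθ₁ hC₂ hθ₂ hn ws hws h₀ h₁).2.2 (add_nonneg ?_ (sq_nonneg _))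
  refine List.sum_nonneg ?_
  intro r hr
  rw [List.mem_map] at hr
  obtain ⟨xw, _, rfl⟩ := hr
  positivity

/-- THE NAMED WEIGHT: a PRODUCT OF LOOP VARIABLES of the `n`-fold iterated average from level `k`, for a list of
(base site, word) pairs at level `k + n` — the cell's `prodLoop`-type weights pulled back by `n` averaging steps
(`T4ObservableTelescopeTwoRun.pullback av k n f = f ∘ iterFrom av k n`, not imported here). [folklore] -/
def loopProdW (av : ∀ j, Averaging P j G) (k n : ℕ) (ws : List (Site P (k + n) × List (Letter P.d))) :
    GaugeField P k G → ℝ :=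
  fun U => (ws.map fun xw => loopAt (iterFrom av k n U) (walk xw.1 xw.2)).prod

omit [DecidableEq (PBond P k)] in
/-- The junction one-liner with the cell's pull-back vocabulary: `loopProdW av k n ws = (W ↦ ∏ᵢ W_{Cᵢ}(W)) ∘ iterFrom
av k n` (`T4ObservableTelescopeTwoRun.pullback av k n f` unfolds to `f ∘ iterFrom av k n`; not imported). [folklore] -/
theorem loopProdW_eq_comp (av : ∀ j, Averaging P j G) (k n : ℕ) (ws : List (Site P (k + n) × List (Letter P.d))) :
    loopProdW av k n ws = (fun W => (ws.map fun xw => loopAt W (walk xw.1 xw.2)).prod) ∘ iterFrom av k n :=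
  rfl

/-- THE PAIR RATE of a product of loop variables: `Σᵢ C₂|wᵢ|θ₂ⁿ + (Σᵢ C₁|wᵢ|θ₁ⁿ)²`. [folklore] -/
def loopProdRate {σ : Type*} {d : ℕ} (C₁ θ₁ C₂ θ₂ : ℝ) (n : ℕ) (ws : List (σ × List (Letter d))) : ℝ :=
  (ws.map fun xw => C₂ * (xw.2.length : ℝ) * θ₂ ^ n).sum
    + (ws.map fun xw => C₁ * (xw.2.length : ℝ) * θ₁ ^ n).sum ^ 2

omit [DecidableEq (PBond P k)] [GaugeGroup G] in
/-- The pair rate is non-negative for non-negative constants. [folklore] -/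
theorem loopProdRate_nonneg {σ : Type*} {d : ℕ} {C₁ θ₁ C₂ θ₂ : ℝ} (hC₂ : 0 ≤ C₂) (hθ₂ : 0 ≤ θ₂) (n : ℕ)
    (ws : List (σ × List (Letter d))) : 0 ≤ loopProdRate C₁ θ₁ C₂ θ₂ n ws := by
  refine add_nonneg (List.sum_nonneg ?_) (sq_nonneg _)
  intro r hr
  rw [List.mem_map] at hr
  obtain ⟨xw, _, rfl⟩ := hr
  positivity

omit [DecidableEq (PBond P k)] in
/-- `|loopProdW| ≤ 1` (regular gauge group). [folklore] -/
theorem abs_loopProdW_le_one [MeasurableSpace G] [RegularGaugeGroup G] (av : ∀ j, Averaging P j G) (k n : ℕ) :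
    ∀ (ws : List (Site P (k + n) × List (Letter P.d))) (U : GaugeField P k G), |loopProdW av k n ws U| ≤ 1
  | [], U => by simp [loopProdW]
  | xw :: ws, U => by
    have h := abs_loopProdW_le_one av k n ws U
    simp only [loopProdW, List.map_cons, List.prod_cons, abs_mul] at h ⊢
    exact mul_le_one₀ (abs_loopAt_le_one _ _) (abs_nonneg _) h

omit [DecidableEq (PBond P k)] in
/-- Iterated averaging from level `k` is measurable when each averaging map is (cf.
`T4Continuum.measurable_iter`). [folklore] -/
theorem measurable_iterFrom [MeasurableSpace G] (av : ∀ j, Averaging P j G) (hav : ∀ j, Measurable (av j).avg)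
    (k : ℕ) : ∀ n : ℕ, Measurable (iterFrom av k n)
  | 0 => measurable_id
  | n + 1 => (hav (k + n)).comp (measurable_iterFrom av hav k n)

omit [DecidableEq (PBond P k)] in
/-- `loopProdW` is measurable when each averaging map is (stated eta-expanded; `Measurable (loopProdW av k n ws)` by
`exact`). [folklore] -/
theorem measurable_loopProdW [MeasurableSpace G] [RegularGaugeGroup G] (av : ∀ j, Averaging P j G)
    (hav : ∀ j, Measurable (av j).avg) (k n : ℕ) :
    ∀ ws : List (Site P (k + n) × List (Letter P.d)), Measurable fun U => loopProdW av k n ws U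
  | [] => by
    simp only [loopProdW, List.map_nil, List.prod_nil]
    exact measurable_const
  | xw :: ws => by
    have h := measurable_loopProdW av hav k n ws
    simp only [loopProdW, List.map_cons, List.prod_cons] at h ⊢
    exact ((measurable_loopAt _).comp (measurable_iterFrom av hav k n)).mul h

/-- **THE FIBRE SEPARABLE EXPANSION OF THE NAMED WEIGHT `loopProdW`** (restatement of
`abs_fibreSepRem_loopProd_le`): `|fibreSepRem| ≤ loopProdRate · (Σ_{b∈s} bdist(y₀ b, y b)) · tv(V₀←y₀, V←y)`.
[folklore] -/
theorem abs_fibreSepRem_loopProdW_le [MeasurableSpace G] [RegularGaugeGroup G] {av : ∀ j, Averaging P j G}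
    {dom : ∀ j, Set (GaugeField P j G)} {C₁ θ₁ C₂ θ₂ : ℝ} (hder : LoopDerivBound av dom C₁ θ₁)
    (hpair : LoopPairDerivBound av dom C₂ θ₂) (hconv : FibreConvex dom) (hC₁ : 0 ≤ C₁) (hθ₁ : 0 ≤ θ₁)
    (hC₂ : 0 ≤ C₂) (hθ₂ : 0 ≤ θ₂) {n : ℕ} (hn : k + n ≤ P.m + P.K)
    (ws : List (Site P (k + n) × List (Letter P.d))) (hws : ∀ xw ∈ ws, walkEnd xw.1 xw.2 = xw.1)
    (s : Finset (PBond P k)) {V V₀ : GaugeField P k G} {y y₀ : s → G} (h₀ : updateFinset V₀ s y₀ ∈ dom k)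
    (h₁ : updateFinset V s y ∈ dom k) :
    |fibreSepRem s (loopProdW av k n ws) V₀ y₀ V y|
      ≤ loopProdRate C₁ θ₁ C₂ θ₂ n ws * (∑ b : s, bdist (y₀ b) (y b))
          * tv (updateFinset V₀ s y₀) (updateFinset V s y) :=
  abs_fibreSepRem_loopProd_le hder hpair hconv hC₁ hθ₁ hC₂ hθ₂ hn ws hws s h₀ h₁

/-- THE SIZE OF A ONE-BOND INCREMENT from the row's first-difference shape `LoopDerivBound av dom C₁ θ₁`:
`|bondIncr b| ≤ C₁·|w|·bdist(y₀ b, y b)·θ₁ⁿ` when both configurations lie in the domain — the oscillation / range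
bound of the fibre readings whose conditional means §3 asks to be suppressed. [folklore] -/
theorem abs_bondIncr_loop_le {av : ∀ j, Averaging P j G} {dom : ∀ j, Set (GaugeField P j G)} {C₁ θ₁ : ℝ}
    (hder : LoopDerivBound av dom C₁ θ₁) {n : ℕ} (hn : k + n ≤ P.m + P.K) {x : Site P (k + n)}
    {w : List (Letter P.d)} (hw : walkEnd x w = x) (s : Finset (PBond P k)) {V₀ : GaugeField P k G}
    {y y₀ : s → G} (b : s) (h₀ : updateFinset V₀ s y₀ ∈ dom k)
    (hb : updateFinset V₀ s (Function.update y₀ b (y b)) ∈ dom k) :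
    |bondIncr s (fun U => loopAt (iterFrom av k n U) (walk x w)) V₀ y₀ y b|
      ≤ C₁ * (w.length : ℝ) * bdist (y₀ b) (y b) * θ₁ ^ n := by
  have h := hder k n hn x w hw b (updateFinset V₀ s (Function.update y₀ b (y b))) (updateFinset V₀ s y₀) hb h₀
    (fun c hc => by
      by_cases hcs : c ∈ s
      · have hne : (⟨c, hcs⟩ : s) ≠ b := fun h' => hc (congrArg Subtype.val h')
        simp [updateFinset, hcs, Function.update_of_ne hne]
      · simp [updateFinset, hcs])
  have e1 : updateFinset V₀ s (Function.update y₀ b (y b)) b = y b := by simp [updateFinset, b.2]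
  have e2 : updateFinset V₀ s y₀ (b : PBond P k) = y₀ b := by simp [updateFinset, b.2]
  rw [e1, e2, bdist_comm] at h
  simpa only [bondIncr] using h

end Fibre

/-! ## §3 The junction with the (CM) channel: the separable expansion IS the weight chart of
`T4CondMeanChannelInsert.condMeanGap_of_suppression` (scalar inserts = the one-bond increments, unit amplitudes,
fibre-independent reference `m V = g(V ← y₀)`) -/

section Channel

open B15.BasicStep T4DressedR T4DressingDefect T4FirstOrderSize T4CondLawRelative T4ObservableTelescope
open T4CondMeanChannel T4CondMeanChannelInsert T4Continuum T4AvgSensitivity T4AvgDerivBound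

variable {P : Params} {j : ℕ} {G : Type*} [GaugeGroup G] [MeasurableSpace G] [HaarData G]
variable [DecidableEq (PBond P j)]

/-- THE INCREMENT READING: the scalar bond-insert field `b ↦ bondIncr b` read through the fibre of `U`
(`T4CondMeanChannel.fibreReading`; exterior-independent by construction). [folklore] -/
def incrReading (s : Finset (PBond P j)) (g : Density P j G) (V₀ : GaugeField P j G) (y₀ : s → G) :
    GaugeField P j G → s → ℝ :=
  fibreReading s fun y b => bondIncr s g V₀ y₀ y b

omit [GaugeGroup G] [MeasurableSpace G] [HaarData G] in
/-- Unfolding lemma: `incrReading U b = g(V₀ ← (y₀; b ← U_b)) − g(V₀ ← y₀)`. [folklore] -/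
theorem incrReading_apply (s : Finset (PBond P j)) (g : Density P j G) (V₀ : GaugeField P j G) (y₀ : s → G)
    (U : GaugeField P j G) (b : s) :
    incrReading s g V₀ y₀ U b = g (updateFinset V₀ s (Function.update y₀ b (U b))) - g (updateFinset V₀ s y₀) :=
  rfl

omit [GaugeGroup G] [MeasurableSpace G] [HaarData G] in
/-- The (CM) channel's weight chart with unit amplitudes and the increment reading IS the separable expansion:
`g(V←y) − g(V←y₀) − linDensity 1 univ 1 (incrReading) (V←y) = fibreSepRem`. [folklore] -/
theorem chart_eq_fibreSepRem (s : Finset (PBond P j)) (g : Density P j G) (V₀ : GaugeField P j G) (y₀ : s → G)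
    (V : GaugeField P j G) (y : s → G) :
    g (updateFinset V s y) - g (updateFinset V s y₀)
        - linDensity 1 Finset.univ (fun _ : s => (1 : ℝ)) (incrReading s g V₀ y₀) (updateFinset V s y)
      = fibreSepRem s g V₀ y₀ V y := by
  simp only [fibreSepRem, linDensity_apply, linTerm, incrReading, fibreReading_updateFinset, one_mul,
    RCLike.inner_apply, map_one, mul_one]

/-- **THE JUNCTION.**  For one dressed term (`TermProvisos s ins old C`), a measurable bounded weight `g`, a reference
point `(V₀, y₀)` and the two laws' CONDITIONAL-MEAN SUPPRESSION data for the INCREMENT READING (domains covering the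
old term's live set, deviations capped there), separability remainders `q₁` (on the support of `old(V←·)`) and `q₂`
(on the support of `ins(V←·)` at old-live `V`) give
`CondMeanGap s ins old g ((|s|·lip₁·d₁ + q₁) + (|s|·lip₂·d₂ + q₂))` — `condMeanGap_of_suppression` with `E = ℝ`,
`β = s`, `t = 1`, unit amplitudes, `Φ = incrReading`, `m V = g(V ← y₀)`. [folklore] -/
theorem condMeanGap_of_separable {s : Finset (PBond P j)} {ins old : Density P j G} {C : ℝ}
    (hP : TermProvisos s ins old C) {g : Density P j G} (hg : Measurable g) {Bg : ℝ} (hBg : ∀ U, |g U| ≤ Bg)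
    (V₀ : GaugeField P j G) (y₀ : s → G) {dom₁ dom₂ : Set (GaugeField P j G)}
    {dev₁ dev₂ : GaugeField P j G → ℝ} {lip₁ lip₂ d₁ d₂ q₁ q₂ : ℝ}
    (hsup₁ : CondMeanSuppression dom₁ (condMeanField s old (incrReading s g V₀ y₀)) Finset.univ dev₁ lip₁)
    (hsup₂ : CondMeanSuppression dom₂ (condMeanField s ins (incrReading s g V₀ y₀)) Finset.univ dev₂ lip₂)
    (hdom₁ : liveSet s old ⊆ dom₁) (hdom₂ : liveSet s old ⊆ dom₂) (hdev₁ : ∀ V ∈ liveSet s old, dev₁ V ≤ d₁)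
    (hdev₂ : ∀ V ∈ liveSet s old, dev₂ V ≤ d₂) (hlip₁ : 0 ≤ lip₁) (hlip₂ : 0 ≤ lip₂)
    (hq₁ : ∀ (V : GaugeField P j G) (y : s → G), old (updateFinset V s y) ≠ 0 → |fibreSepRem s g V₀ y₀ V y| ≤ q₁)
    (hq₂ : ∀ V ∈ liveSet s old, ∀ y : s → G, ins (updateFinset V s y) ≠ 0 → |fibreSepRem s g V₀ y₀ V y| ≤ q₂) :
    CondMeanGap s ins old g
      (((s.card : ℝ) * (lip₁ * d₁) + q₁) + ((s.card : ℝ) * (lip₂ * d₂) + q₂)) := by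
  have hmI : FibreIndep s (fun V => g (updateFinset V s y₀)) := fun x y => by
    simp only [Function.updateFinset_updateFinset_of_subset (subset_refl s)]
  have hmm : Measurable fun V : GaugeField P j G => g (updateFinset V s y₀) :=
    hg.comp measurable_updateFinset_left
  have hBm : ∀ U : GaugeField P j G, |g (updateFinset U s y₀)| ≤ Bg := fun U => hBg _
  have hA : ∀ b ∈ (Finset.univ : Finset s), ‖(fun _ : s => (1 : ℝ)) b‖ ≤ 1 := fun b _ => by simp
  have hΦ : ∀ b ∈ (Finset.univ : Finset s), StronglyMeasurable fun U => incrReading s g V₀ y₀ U b := by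
    intro b _
    have hmeas : Measurable fun U : GaugeField P j G => g (updateFinset V₀ s (Function.update y₀ b (U b))) :=
      hg.comp (measurable_updateFinset.comp ((measurable_update y₀).comp (measurable_pi_apply _)))
    exact (hmeas.sub measurable_const).stronglyMeasurable
  have hR : ∀ b ∈ (Finset.univ : Finset s), ∀ U, ‖incrReading s g V₀ y₀ U b‖ ≤ Bg + Bg := by
    intro b _ U
    rw [Real.norm_eq_abs, incrReading_apply]
    exact (abs_sub _ _).trans (add_le_add (hBg _) (hBg _))
  have h := condMeanGap_of_suppression hP hg hBg hmm hBm hmI 1 hA hΦ hR hsup₁ hsup₂ hdom₁ hdom₂ hdev₁ hdev₂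
    hlip₁ hlip₂ (fun V y hy => by rw [chart_eq_fibreSepRem]; exact hq₁ V y hy)
    (fun V hV y hy => by rw [chart_eq_fibreSepRem]; exact hq₂ V hV y hy)
  simpa only [abs_one, one_mul, mul_one, Finset.card_univ, Fintype.card_coe] using h

/-- **THE (CM) CHANNEL FOR A PRODUCT OF LOOP VARIABLES OF AN ITERATED AVERAGE — THE COMPLETE HYPOTHESIS LIST**
(answer to the typing request «state precisely which modulus the channel consumes»).  For one dressed term
(`TermProvisos s ins old C`) and the weight `loopProdW av j n ws` (closed walks at level `j + n`, measurable averaging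
maps, regular gauge group):
* AVERAGING SIDE — exactly the ROW's typed shapes of `T4AvgDerivBound` (b07): `LoopDerivBound av dom C₁ θ₁`,
  `LoopPairDerivBound av dom C₂ θ₂` on a `FibreConvex dom` (no new averaging-side modulus is introduced);
* LAW SIDE — the two laws' conditional-mean suppression data for the INCREMENT READING of the weight at the
  reference point `(V₀, y₀)` (`CondMeanSuppression`, domains covering the old term's live set, deviations capped by
  `d₁, d₂` there);
* COVER / WINDOW — the reference configuration `V₀ ← y₀` lies in `dom j`; every configuration `V ← y` in the support
  of `old(V ← ·)` (resp. of `ins(V ← ·)` at old-live `V`) lies in `dom j` with fibre variation × total variation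
  `(Σ_b bdist(y₀ b, y b))·tv(V₀←y₀, V←y) ≤ Δ₁` (resp. `≤ Δ₂`).
Conclusion: `CondMeanGap s ins old (loopProdW av j n ws) ((|s|·lip₁·d₁ + rate·Δ₁) + (|s|·lip₂·d₂ + rate·Δ₂))` with
`rate = loopProdRate C₁ θ₁ C₂ θ₂ n ws = Σᵢ C₂|wᵢ|θ₂ⁿ + (Σᵢ C₁|wᵢ|θ₁ⁿ)²`. [folklore] -/
theorem condMeanGap_of_loopProd [RegularGaugeGroup G] {s : Finset (PBond P j)} {ins old : Density P j G} {C : ℝ}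
    (hP : TermProvisos s ins old C) {av : ∀ i, Averaging P i G} (hav : ∀ i, Measurable (av i).avg)
    {dom : ∀ i, Set (GaugeField P i G)} {C₁ θ₁ C₂ θ₂ : ℝ} (hder : LoopDerivBound av dom C₁ θ₁)
    (hpair : LoopPairDerivBound av dom C₂ θ₂) (hconv : FibreConvex dom) (hC₁ : 0 ≤ C₁) (hθ₁ : 0 ≤ θ₁)
    (hC₂ : 0 ≤ C₂) (hθ₂ : 0 ≤ θ₂) {n : ℕ} (hn : j + n ≤ P.m + P.K)
    (ws : List (Site P (j + n) × List (Letter P.d))) (hws : ∀ xw ∈ ws, walkEnd xw.1 xw.2 = xw.1)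
    (V₀ : GaugeField P j G) (y₀ : s → G) (h₀ : updateFinset V₀ s y₀ ∈ dom j)
    {dom₁ dom₂ : Set (GaugeField P j G)} {dev₁ dev₂ : GaugeField P j G → ℝ} {lip₁ lip₂ d₁ d₂ Δ₁ Δ₂ : ℝ}
    (hsup₁ : CondMeanSuppression dom₁ (condMeanField s old (incrReading s (loopProdW av j n ws) V₀ y₀))
      Finset.univ dev₁ lip₁)
    (hsup₂ : CondMeanSuppression dom₂ (condMeanField s ins (incrReading s (loopProdW av j n ws) V₀ y₀))
      Finset.univ dev₂ lip₂)
    (hdom₁ : liveSet s old ⊆ dom₁) (hdom₂ : liveSet s old ⊆ dom₂) (hdev₁ : ∀ V ∈ liveSet s old, dev₁ V ≤ d₁)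
    (hdev₂ : ∀ V ∈ liveSet s old, dev₂ V ≤ d₂) (hlip₁ : 0 ≤ lip₁) (hlip₂ : 0 ≤ lip₂)
    (hcov₁ : ∀ (V : GaugeField P j G) (y : s → G), old (updateFinset V s y) ≠ 0 →
      updateFinset V s y ∈ dom j ∧
        (∑ b : s, bdist (y₀ b) (y b)) * tv (updateFinset V₀ s y₀) (updateFinset V s y) ≤ Δ₁)
    (hcov₂ : ∀ V ∈ liveSet s old, ∀ y : s → G, ins (updateFinset V s y) ≠ 0 →
      updateFinset V s y ∈ dom j ∧
        (∑ b : s, bdist (y₀ b) (y b)) * tv (updateFinset V₀ s y₀) (updateFinset V s y) ≤ Δ₂) :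
    CondMeanGap s ins old (loopProdW av j n ws)
      (((s.card : ℝ) * (lip₁ * d₁) + loopProdRate C₁ θ₁ C₂ θ₂ n ws * Δ₁)
        + ((s.card : ℝ) * (lip₂ * d₂) + loopProdRate C₁ θ₁ C₂ θ₂ n ws * Δ₂)) := by
  have hrate := loopProdRate_nonneg (C₁ := C₁) (θ₁ := θ₁) hC₂ hθ₂ n ws
  refine condMeanGap_of_separable hP (measurable_loopProdW av hav j n ws) (abs_loopProdW_le_one av j n ws) V₀ y₀
    hsup₁ hsup₂ hdom₁ hdom₂ hdev₁ hdev₂ hlip₁ hlip₂ (fun V y hV => ?_) (fun V hV y hy => ?_)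
  · obtain ⟨hmem, hΔ⟩ := hcov₁ V y hV
    calc |fibreSepRem s (loopProdW av j n ws) V₀ y₀ V y|
        ≤ loopProdRate C₁ θ₁ C₂ θ₂ n ws * (∑ b : s, bdist (y₀ b) (y b))
            * tv (updateFinset V₀ s y₀) (updateFinset V s y) :=
          abs_fibreSepRem_loopProdW_le hder hpair hconv hC₁ hθ₁ hC₂ hθ₂ hn ws hws s h₀ hmem
      _ = loopProdRate C₁ θ₁ C₂ θ₂ n ws * ((∑ b : s, bdist (y₀ b) (y b))
            * tv (updateFinset V₀ s y₀) (updateFinset V s y)) := mul_assoc _ _ _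
      _ ≤ loopProdRate C₁ θ₁ C₂ θ₂ n ws * Δ₁ := mul_le_mul_of_nonneg_left hΔ hrate
  · obtain ⟨hmem, hΔ⟩ := hcov₂ V hV y hy
    calc |fibreSepRem s (loopProdW av j n ws) V₀ y₀ V y|
        ≤ loopProdRate C₁ θ₁ C₂ θ₂ n ws * (∑ b : s, bdist (y₀ b) (y b))
            * tv (updateFinset V₀ s y₀) (updateFinset V s y) :=
          abs_fibreSepRem_loopProdW_le hder hpair hconv hC₁ hθ₁ hC₂ hθ₂ hn ws hws s h₀ hmem
      _ = loopProdRate C₁ θ₁ C₂ θ₂ n ws * ((∑ b : s, bdist (y₀ b) (y b))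
            * tv (updateFinset V₀ s y₀) (updateFinset V s y)) := mul_assoc _ _ _
      _ ≤ loopProdRate C₁ θ₁ C₂ θ₂ n ws * Δ₂ := mul_le_mul_of_nonneg_left hΔ hrate

end Channel

/-! ## §4 [v1.1] The LOCAL-REFERENCE variant: reference exterior = the configuration's own exterior — the remainder
has NO exterior term (`rate·(fibre variation)²`), the increment reading becomes exterior-DEPENDENT -/

section LocalRef

open B15.BasicStep T4DressedR T4DressingDefect T4FirstOrderSize T4CondLawRelative T4ObservableTelescope
open T4CondMeanChannel T4CondMeanChannelInsert T4Continuum T4AvgSensitivity T4AvgDerivBound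

variable {P : Params} {j : ℕ} {G : Type*} [GaugeGroup G] [MeasurableSpace G] [HaarData G]
variable [DecidableEq (PBond P j)]

/-- THE LOCAL INCREMENT READING `U ↦ (b ↦ g(U ← (y₀; b ← U_b)) − g(U ← y₀))`: the one-bond increments of the weight
at the configuration's OWN exterior (an exterior-DEPENDENT reading; compare `incrReading`, whose reference exterior `V₀`
is fixed and which is a `fibreReading`). [folklore] -/
def incrReadingLoc (s : Finset (PBond P j)) (g : Density P j G) (y₀ : s → G) : GaugeField P j G → s → ℝ :=
  fun U b => g (updateFinset U s (Function.update y₀ b (U b))) - g (updateFinset U s y₀)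

omit [GaugeGroup G] [MeasurableSpace G] [HaarData G] in
/-- On the fibre through `V`: `incrReadingLoc (V ← y) b = bondIncr s g V y₀ y b` (reference exterior `V`). [folklore] -/
theorem incrReadingLoc_updateFinset (s : Finset (PBond P j)) (g : Density P j G) (y₀ : s → G)
    (V : GaugeField P j G) (y : s → G) (b : s) :
    incrReadingLoc s g y₀ (updateFinset V s y) b = bondIncr s g V y₀ y b := by
  have hb : updateFinset V s y (b : PBond P j) = y b := by simp [Function.updateFinset, b.2]
  simp only [incrReadingLoc, bondIncr, hb, Function.updateFinset_updateFinset_of_subset (subset_refl s)]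

omit [GaugeGroup G] [MeasurableSpace G] [HaarData G] in
/-- The (CM) channel's weight chart with unit amplitudes and the LOCAL increment reading IS the separable expansion with
reference exterior `V`: `g(V←y) − g(V←y₀) − linDensity 1 univ 1 (incrReadingLoc) (V←y) = fibreSepRem s g V y₀ V y`.
[folklore] -/
theorem chartLoc_eq_fibreSepRem (s : Finset (PBond P j)) (g : Density P j G) (y₀ : s → G) (V : GaugeField P j G)
    (y : s → G) :
    g (updateFinset V s y) - g (updateFinset V s y₀)
        - linDensity 1 Finset.univ (fun _ : s => (1 : ℝ)) (incrReadingLoc s g y₀) (updateFinset V s y)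
      = fibreSepRem s g V y₀ V y := by
  simp only [fibreSepRem, linDensity_apply, linTerm, incrReadingLoc_updateFinset, one_mul, RCLike.inner_apply,
    map_one, mul_one]

omit [MeasurableSpace G] [HaarData G] in
/-- Two configurations with the same exterior: the total variation is the FIBRE variation. [folklore] -/
theorem tv_updateFinset_updateFinset (s : Finset (PBond P j)) (V : GaugeField P j G) (y₀ y : s → G) :
    tv (updateFinset V s y₀) (updateFinset V s y) = ∑ b : s, bdist (y₀ b) (y b) := by
  rw [tv_eq_sum_of_agreeOff s _ _ (fun b hb => by simp [Function.updateFinset, hb]), ← Finset.sum_coe_sort s]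
  refine Finset.sum_congr rfl fun b _ => ?_
  simp [Function.updateFinset, b.2]

omit [HaarData G] in
/-- **THE FIBRE SEPARABLE EXPANSION OF `loopProdW` WITH LOCAL REFERENCE**: both configurations on the fibre through
`V` in the domain ⇒ `|fibreSepRem s (loopProdW av j n ws) V y₀ V y| ≤ loopProdRate · (Σ_{b∈s} bdist(y₀ b, y b))²` —
second order in the fibre displacement, NO exterior term. [folklore] -/
theorem abs_fibreSepRem_loopProdW_loc_le [RegularGaugeGroup G] {av : ∀ i, Averaging P i G}
    {dom : ∀ i, Set (GaugeField P i G)} {C₁ θ₁ C₂ θ₂ : ℝ} (hder : LoopDerivBound av dom C₁ θ₁)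
    (hpair : LoopPairDerivBound av dom C₂ θ₂) (hconv : FibreConvex dom) (hC₁ : 0 ≤ C₁) (hθ₁ : 0 ≤ θ₁)
    (hC₂ : 0 ≤ C₂) (hθ₂ : 0 ≤ θ₂) {n : ℕ} (hn : j + n ≤ P.m + P.K)
    (ws : List (Site P (j + n) × List (Letter P.d))) (hws : ∀ xw ∈ ws, walkEnd xw.1 xw.2 = xw.1)
    (s : Finset (PBond P j)) {V : GaugeField P j G} {y y₀ : s → G} (h₀ : updateFinset V s y₀ ∈ dom j)
    (h₁ : updateFinset V s y ∈ dom j) :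
    |fibreSepRem s (loopProdW av j n ws) V y₀ V y|
      ≤ loopProdRate C₁ θ₁ C₂ θ₂ n ws * (∑ b : s, bdist (y₀ b) (y b)) ^ 2 := by
  calc |fibreSepRem s (loopProdW av j n ws) V y₀ V y|
      ≤ loopProdRate C₁ θ₁ C₂ θ₂ n ws * (∑ b : s, bdist (y₀ b) (y b))
          * tv (updateFinset V s y₀) (updateFinset V s y) :=
        abs_fibreSepRem_loopProdW_le hder hpair hconv hC₁ hθ₁ hC₂ hθ₂ hn ws hws s h₀ h₁
    _ = loopProdRate C₁ θ₁ C₂ θ₂ n ws * (∑ b : s, bdist (y₀ b) (y b)) ^ 2 := by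
        rw [tv_updateFinset_updateFinset]; ring

/-- **THE JUNCTION WITH LOCAL REFERENCE.**  As `condMeanGap_of_separable`, with `Φ = incrReadingLoc s g y₀` (the LAW
SIDE must now suppress the conditional means of an exterior-DEPENDENT reading) and the separability remainders taken
with reference exterior `V` itself: `|fibreSepRem s g V y₀ V y| ≤ qᵢ` on the live configurations. [folklore] -/
theorem condMeanGap_of_separableLoc {s : Finset (PBond P j)} {ins old : Density P j G} {C : ℝ}
    (hP : TermProvisos s ins old C) {g : Density P j G} (hg : Measurable g) {Bg : ℝ} (hBg : ∀ U, |g U| ≤ Bg)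
    (y₀ : s → G) {dom₁ dom₂ : Set (GaugeField P j G)} {dev₁ dev₂ : GaugeField P j G → ℝ}
    {lip₁ lip₂ d₁ d₂ q₁ q₂ : ℝ}
    (hsup₁ : CondMeanSuppression dom₁ (condMeanField s old (incrReadingLoc s g y₀)) Finset.univ dev₁ lip₁)
    (hsup₂ : CondMeanSuppression dom₂ (condMeanField s ins (incrReadingLoc s g y₀)) Finset.univ dev₂ lip₂)
    (hdom₁ : liveSet s old ⊆ dom₁) (hdom₂ : liveSet s old ⊆ dom₂) (hdev₁ : ∀ V ∈ liveSet s old, dev₁ V ≤ d₁)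
    (hdev₂ : ∀ V ∈ liveSet s old, dev₂ V ≤ d₂) (hlip₁ : 0 ≤ lip₁) (hlip₂ : 0 ≤ lip₂)
    (hq₁ : ∀ (V : GaugeField P j G) (y : s → G), old (updateFinset V s y) ≠ 0 → |fibreSepRem s g V y₀ V y| ≤ q₁)
    (hq₂ : ∀ V ∈ liveSet s old, ∀ y : s → G, ins (updateFinset V s y) ≠ 0 → |fibreSepRem s g V y₀ V y| ≤ q₂) :
    CondMeanGap s ins old g
      (((s.card : ℝ) * (lip₁ * d₁) + q₁) + ((s.card : ℝ) * (lip₂ * d₂) + q₂)) := by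
  have hmI : FibreIndep s (fun V => g (updateFinset V s y₀)) := fun x y => by
    simp only [Function.updateFinset_updateFinset_of_subset (subset_refl s)]
  have hmm : Measurable fun V : GaugeField P j G => g (updateFinset V s y₀) :=
    hg.comp measurable_updateFinset_left
  have hBm : ∀ U : GaugeField P j G, |g (updateFinset U s y₀)| ≤ Bg := fun U => hBg _
  have hA : ∀ b ∈ (Finset.univ : Finset s), ‖(fun _ : s => (1 : ℝ)) b‖ ≤ 1 := fun b _ => by simp
  have hΦ : ∀ b ∈ (Finset.univ : Finset s), StronglyMeasurable fun U => incrReadingLoc s g y₀ U b := by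
    intro b _
    have h1 : Measurable fun U : GaugeField P j G => Function.update y₀ b (U (b : PBond P j)) :=
      (measurable_update y₀).comp (measurable_pi_apply (b : PBond P j))
    have h2 : Measurable fun U : GaugeField P j G => updateFinset U s (Function.update y₀ b (U (b : PBond P j))) :=
      (measurable_updateFinset' (s := s)).comp (measurable_id.prodMk h1)
    exact ((hg.comp h2).sub hmm).stronglyMeasurable
  have hR : ∀ b ∈ (Finset.univ : Finset s), ∀ U, ‖incrReadingLoc s g y₀ U b‖ ≤ Bg + Bg := by
    intro b _ U
    rw [Real.norm_eq_abs]
    exact (abs_sub _ _).trans (add_le_add (hBg _) (hBg _))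
  have h := condMeanGap_of_suppression hP hg hBg hmm hBm hmI 1 hA hΦ hR hsup₁ hsup₂ hdom₁ hdom₂ hdev₁ hdev₂
    hlip₁ hlip₂ (fun V y hy => by rw [chartLoc_eq_fibreSepRem]; exact hq₁ V y hy)
    (fun V hV y hy => by rw [chartLoc_eq_fibreSepRem]; exact hq₂ V hV y hy)
  simpa only [abs_one, one_mul, mul_one, Finset.card_univ, Fintype.card_coe] using h

/-- **THE (CM) CHANNEL FOR `loopProdW` WITH LOCAL REFERENCE — COMPLETE HYPOTHESIS LIST.**  As
`condMeanGap_of_loopProd` but: LAW SIDE = suppression data for the exterior-DEPENDENT reading `incrReadingLoc`;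
COVER / WINDOW = both `V ← y₀` and `V ← y` in `dom j` and `(Σ_b bdist(y₀ b, y b))² ≤ Δᵢ` on the live configurations
(NO exterior variation).  Conclusion `CondMeanGap … ((|s|·lip₁·d₁ + rate·Δ₁) + (|s|·lip₂·d₂ + rate·Δ₂))`. [folklore] -/
theorem condMeanGap_of_loopProdLoc [RegularGaugeGroup G] {s : Finset (PBond P j)} {ins old : Density P j G}
    {C : ℝ} (hP : TermProvisos s ins old C) {av : ∀ i, Averaging P i G} (hav : ∀ i, Measurable (av i).avg)
    {dom : ∀ i, Set (GaugeField P i G)} {C₁ θ₁ C₂ θ₂ : ℝ} (hder : LoopDerivBound av dom C₁ θ₁)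
    (hpair : LoopPairDerivBound av dom C₂ θ₂) (hconv : FibreConvex dom) (hC₁ : 0 ≤ C₁) (hθ₁ : 0 ≤ θ₁)
    (hC₂ : 0 ≤ C₂) (hθ₂ : 0 ≤ θ₂) {n : ℕ} (hn : j + n ≤ P.m + P.K)
    (ws : List (Site P (j + n) × List (Letter P.d))) (hws : ∀ xw ∈ ws, walkEnd xw.1 xw.2 = xw.1) (y₀ : s → G)
    {dom₁ dom₂ : Set (GaugeField P j G)} {dev₁ dev₂ : GaugeField P j G → ℝ} {lip₁ lip₂ d₁ d₂ Δ₁ Δ₂ : ℝ}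
    (hsup₁ : CondMeanSuppression dom₁ (condMeanField s old (incrReadingLoc s (loopProdW av j n ws) y₀))
      Finset.univ dev₁ lip₁)
    (hsup₂ : CondMeanSuppression dom₂ (condMeanField s ins (incrReadingLoc s (loopProdW av j n ws) y₀))
      Finset.univ dev₂ lip₂)
    (hdom₁ : liveSet s old ⊆ dom₁) (hdom₂ : liveSet s old ⊆ dom₂) (hdev₁ : ∀ V ∈ liveSet s old, dev₁ V ≤ d₁)
    (hdev₂ : ∀ V ∈ liveSet s old, dev₂ V ≤ d₂) (hlip₁ : 0 ≤ lip₁) (hlip₂ : 0 ≤ lip₂)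
    (hcov₁ : ∀ (V : GaugeField P j G) (y : s → G), old (updateFinset V s y) ≠ 0 →
      updateFinset V s y₀ ∈ dom j ∧ updateFinset V s y ∈ dom j ∧ (∑ b : s, bdist (y₀ b) (y b)) ^ 2 ≤ Δ₁)
    (hcov₂ : ∀ V ∈ liveSet s old, ∀ y : s → G, ins (updateFinset V s y) ≠ 0 →
      updateFinset V s y₀ ∈ dom j ∧ updateFinset V s y ∈ dom j ∧ (∑ b : s, bdist (y₀ b) (y b)) ^ 2 ≤ Δ₂) :
    CondMeanGap s ins old (loopProdW av j n ws)
      (((s.card : ℝ) * (lip₁ * d₁) + loopProdRate C₁ θ₁ C₂ θ₂ n ws * Δ₁)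
        + ((s.card : ℝ) * (lip₂ * d₂) + loopProdRate C₁ θ₁ C₂ θ₂ n ws * Δ₂)) := by
  have hrate := loopProdRate_nonneg (C₁ := C₁) (θ₁ := θ₁) hC₂ hθ₂ n ws
  refine condMeanGap_of_separableLoc hP (measurable_loopProdW av hav j n ws) (abs_loopProdW_le_one av j n ws) y₀
    hsup₁ hsup₂ hdom₁ hdom₂ hdev₁ hdev₂ hlip₁ hlip₂ (fun V y hV => ?_) (fun V hV y hy => ?_)
  · obtain ⟨h₀, h₁, hΔ⟩ := hcov₁ V y hV
    exact (abs_fibreSepRem_loopProdW_loc_le hder hpair hconv hC₁ hθ₁ hC₂ hθ₂ hn ws hws s h₀ h₁).trans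
      (mul_le_mul_of_nonneg_left hΔ hrate)
  · obtain ⟨h₀, h₁, hΔ⟩ := hcov₂ V hV y hy
    exact (abs_fibreSepRem_loopProdW_loc_le hder hpair hconv hC₁ hθ₁ hC₂ hθ₂ hn ws hws s h₀ h₁).trans
      (mul_le_mul_of_nonneg_left hΔ hrate)

end LocalRef

/-! ## §5 [v1.2] The DIAGONAL of the increment reading: the odd / even split under the bond reflection through the
reference.  The odd part's mean VANISHES EXACTLY under a reflection-symmetric law (the symmetry is a binder); the even
part is half a ONE-BOND SYMMETRIC SECOND DIFFERENCE of the weight — the diagonal self-energy, NOT suppressed by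
flatness (it survives at the reference law), small only by a one-bond second-order rate × the law's one-bond spread -/

section Diagonal

open B15.BasicStep T4DressedR T4DressingDefect T4FirstOrderSize T4CondLawRelative T4ObservableTelescope
open T4CondMeanChannel T4CondMeanChannelInsert T4CovarianceResponse T4Continuum T4AvgSensitivity T4AvgDerivBound

variable {P : Params} {j : ℕ} {G : Type*} [GaugeGroup G] [MeasurableSpace G] [HaarData G]
variable [DecidableEq (PBond P j)]

omit [MeasurableSpace G] [HaarData G] in
/-- THE BOND REFLECTION through `y₀` at `b`: `y ↦ y[b ← y₀_b · y_b⁻¹ · y₀_b]` (the `b`-coordinate is reflected through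
`y₀ b` in the group, the other coordinates are kept). [folklore] -/
def bondReflect {s : Finset (PBond P j)} (y₀ : s → G) (b : s) (y : s → G) : s → G :=
  Function.update y b (y₀ b * (y b)⁻¹ * y₀ b)

omit [MeasurableSpace G] [HaarData G] in
/-- [folklore] -/
@[simp] theorem bondReflect_apply_self {s : Finset (PBond P j)} (y₀ : s → G) (b : s) (y : s → G) :
    bondReflect y₀ b y b = y₀ b * (y b)⁻¹ * y₀ b := Function.update_self ..

omit [MeasurableSpace G] [HaarData G] in
/-- [folklore] -/
theorem bondReflect_apply_ne {s : Finset (PBond P j)} (y₀ : s → G) (b : s) (y : s → G) {c : s} (h : c ≠ b) :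
    bondReflect y₀ b y c = y c := Function.update_of_ne h ..

omit [MeasurableSpace G] [HaarData G] in
/-- The bond reflection is an INVOLUTION. [folklore] -/
theorem bondReflect_bondReflect {s : Finset (PBond P j)} (y₀ : s → G) (b : s) (y : s → G) :
    bondReflect y₀ b (bondReflect y₀ b y) = y := by
  funext c
  by_cases h : c = b
  · subst h
    simp [bondReflect, mul_assoc]
  · simp only [bondReflect, Function.update_of_ne h]

omit [MeasurableSpace G] [HaarData G] in
/-- The reference is FIXED by the reflection. [folklore] -/
theorem bondReflect_ref {s : Finset (PBond P j)} (y₀ : s → G) (b : s) : bondReflect y₀ b y₀ = y₀ := by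
  funext c
  by_cases h : c = b
  · subst h; simp [bondReflect]
  · simp only [bondReflect, Function.update_of_ne h]

omit [MeasurableSpace G] [HaarData G] in
/-- The reflection PRESERVES the distance to the reference at `b` (`dist1` is inversion invariant). [folklore] -/
theorem bdist_bondReflect {s : Finset (PBond P j)} (y₀ : s → G) (b : s) (y : s → G) :
    bdist (y₀ b) (bondReflect y₀ b y b) = bdist (y₀ b) (y b) := by
  have h : (y₀ b)⁻¹ * (y₀ b * (y b)⁻¹ * y₀ b) = ((y₀ b)⁻¹ * y b)⁻¹ := by simp [mul_assoc]
  rw [bondReflect_apply_self, bdist_def, bdist_def, h, GaugeGroup.dist1_inv]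

omit [HaarData G] in
/-- Measurability of the bond reflection (regular gauge group: measurable multiplication and inversion). [folklore] -/
theorem measurable_bondReflect [RegularGaugeGroup G] {s : Finset (PBond P j)} (y₀ : s → G) (b : s) :
    Measurable (bondReflect y₀ b) := by
  have h1 : Measurable fun y : s → G => y₀ b * (y b)⁻¹ * y₀ b :=
    (measurable_const.mul (measurable_pi_apply b).inv).mul measurable_const
  refine measurable_pi_iff.mpr fun c => ?_
  by_cases hc : c = b
  · subst hc
    simp only [bondReflect, Function.update_self]
    exact h1
  · simp only [bondReflect, Function.update_of_ne hc]
    exact measurable_pi_apply c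

/-- The bond reflection as a measurable involution of the fibre. [folklore] -/
def bondReflectEquiv [RegularGaugeGroup G] {s : Finset (PBond P j)} (y₀ : s → G) (b : s) : (s → G) ≃ᵐ (s → G) where
  toFun := bondReflect y₀ b
  invFun := bondReflect y₀ b
  left_inv := bondReflect_bondReflect y₀ b
  right_inv := bondReflect_bondReflect y₀ b
  measurable_toFun := measurable_bondReflect y₀ b
  measurable_invFun := measurable_bondReflect y₀ b

omit [HaarData G] in
/-- [folklore] -/
theorem coe_bondReflectEquiv [RegularGaugeGroup G] {s : Finset (PBond P j)} (y₀ : s → G) (b : s) :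
    ⇑(bondReflectEquiv y₀ b) = bondReflect y₀ b := rfl

/-- THE ODD PART of the one-bond increment under the reflection through the reference at `b`. [folklore] -/
noncomputable def oddIncr (s : Finset (PBond P j)) (g : Density P j G) (V₀ : GaugeField P j G) (y₀ y : s → G) (b : s) : ℝ :=
  (bondIncr s g V₀ y₀ y b - bondIncr s g V₀ y₀ (bondReflect y₀ b y) b) / 2

/-- THE EVEN PART of the one-bond increment under the reflection through the reference at `b`. [folklore] -/
noncomputable def evenIncr (s : Finset (PBond P j)) (g : Density P j G) (V₀ : GaugeField P j G) (y₀ y : s → G) (b : s) : ℝ :=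
  (bondIncr s g V₀ y₀ y b + bondIncr s g V₀ y₀ (bondReflect y₀ b y) b) / 2

omit [MeasurableSpace G] [HaarData G] in
/-- increment = odd + even. [folklore] -/
theorem oddIncr_add_evenIncr (s : Finset (PBond P j)) (g : Density P j G) (V₀ : GaugeField P j G) (y₀ y : s → G)
    (b : s) : oddIncr s g V₀ y₀ y b + evenIncr s g V₀ y₀ y b = bondIncr s g V₀ y₀ y b := by
  simp only [oddIncr, evenIncr]; ring

omit [MeasurableSpace G] [HaarData G] in
/-- The odd part is ODD under the reflection. [folklore] -/
theorem oddIncr_bondReflect (s : Finset (PBond P j)) (g : Density P j G) (V₀ : GaugeField P j G) (y₀ y : s → G)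
    (b : s) : oddIncr s g V₀ y₀ (bondReflect y₀ b y) b = -oddIncr s g V₀ y₀ y b := by
  simp only [oddIncr, bondReflect_bondReflect]; ring

omit [MeasurableSpace G] [HaarData G] in
/-- The even part is EVEN under the reflection. [folklore] -/
theorem evenIncr_bondReflect (s : Finset (PBond P j)) (g : Density P j G) (V₀ : GaugeField P j G) (y₀ y : s → G)
    (b : s) : evenIncr s g V₀ y₀ (bondReflect y₀ b y) b = evenIncr s g V₀ y₀ y b := by
  simp only [evenIncr, bondReflect_bondReflect]; ring

omit [MeasurableSpace G] [HaarData G] in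
/-- THE EVEN PART IS HALF A ONE-BOND SYMMETRIC SECOND DIFFERENCE of the weight at the reference:
`2·evenIncr = g(V₀←(y₀; b←y_b)) − 2·g(V₀←y₀) + g(V₀←(y₀; b←y₀_b·y_b⁻¹·y₀_b))` — the DIAGONAL (self-energy) term.
[folklore] -/
theorem two_mul_evenIncr (s : Finset (PBond P j)) (g : Density P j G) (V₀ : GaugeField P j G) (y₀ y : s → G)
    (b : s) : 2 * evenIncr s g V₀ y₀ y b
      = g (updateFinset V₀ s (Function.update y₀ b (y b))) - 2 * g (updateFinset V₀ s y₀)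
          + g (updateFinset V₀ s (Function.update y₀ b (y₀ b * (y b)⁻¹ * y₀ b))) := by
  simp only [evenIncr, bondIncr, bondReflect_apply_self]; ring

omit [MeasurableSpace G] [HaarData G] in
/-- Both parts vanish at the reference. [folklore] -/
theorem oddIncr_ref (s : Finset (PBond P j)) (g : Density P j G) (V₀ : GaugeField P j G) (y₀ : s → G) (b : s) :
    oddIncr s g V₀ y₀ y₀ b = 0 ∧ evenIncr s g V₀ y₀ y₀ b = 0 := by
  have h0 : bondIncr s g V₀ y₀ y₀ b = 0 := by simp [bondIncr]
  simp only [oddIncr, evenIncr, bondReflect_ref, h0, sub_self, add_zero, zero_div, and_self]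

omit [MeasurableSpace G] [HaarData G] in
/-- Size of the parts from the size of the increments (e.g. `abs_bondIncr_loop_le` and `bdist_bondReflect`: both
`≤ C₁|w|θ₁ⁿ·bdist(y₀ b, y b)` for a loop weight). [folklore] -/
theorem abs_oddIncr_le_of_abs_bondIncr_le (s : Finset (PBond P j)) (g : Density P j G) (V₀ : GaugeField P j G)
    (y₀ y : s → G) (b : s) {K : ℝ} (h₁ : |bondIncr s g V₀ y₀ y b| ≤ K)
    (h₂ : |bondIncr s g V₀ y₀ (bondReflect y₀ b y) b| ≤ K) :
    |oddIncr s g V₀ y₀ y b| ≤ K ∧ |evenIncr s g V₀ y₀ y b| ≤ K := by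
  simp only [oddIncr, evenIncr, abs_div, abs_two]
  constructor
  · rw [div_le_iff₀ two_pos]; exact (abs_sub _ _).trans (by linarith)
  · rw [div_le_iff₀ two_pos]; exact (abs_add_le _ _).trans (by linarith)

omit [MeasurableSpace G] [HaarData G] in
/-- THE EVEN PART FROM A ONE-BOND SECOND-DIFFERENCE BOUND (the consumer-side reading of a one-bond second-order
modulus of the weight — NOT one of b07's typed shapes, whose pair shape requires two DISTINCT bonds; a hypothesis here).
[folklore] -/
theorem abs_evenIncr_le_of_secondDiff (s : Finset (PBond P j)) (g : Density P j G) (V₀ : GaugeField P j G)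
    (y₀ y : s → G) (b : s) {c : ℝ}
    (hdiag : |g (updateFinset V₀ s (Function.update y₀ b (y b))) - 2 * g (updateFinset V₀ s y₀)
        + g (updateFinset V₀ s (Function.update y₀ b (y₀ b * (y b)⁻¹ * y₀ b)))| ≤ c) :
    |evenIncr s g V₀ y₀ y b| ≤ c / 2 := by
  rw [le_div_iff₀ two_pos, mul_comm, ← abs_two, ← abs_mul, two_mul_evenIncr]
  exact hdiag

omit [HaarData G] in
/-- **EXACT MEAN VANISHING OF THE ODD PART** under a law invariant under the bond reflection through the reference at `b`
(the symmetry is the binder `hμ`; integrability of the increment the binder `hint`). [folklore] -/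
theorem integral_oddIncr_eq_zero [RegularGaugeGroup G] (s : Finset (PBond P j)) (g : Density P j G)
    (V₀ : GaugeField P j G) (y₀ : s → G) (b : s) {μ : Measure (s → G)} (hμ : μ.map (bondReflect y₀ b) = μ)
    (hint : Integrable (fun y => bondIncr s g V₀ y₀ y b) μ) : ∫ y, oddIncr s g V₀ y₀ y b ∂μ = 0 := by
  have hcomp : ∫ y, bondIncr s g V₀ y₀ (bondReflect y₀ b y) b ∂μ = ∫ y, bondIncr s g V₀ y₀ y b ∂μ := by
    have h := integral_map_equiv (μ := μ) (bondReflectEquiv y₀ b) (fun y => bondIncr s g V₀ y₀ y b)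
    rw [coe_bondReflectEquiv, hμ] at h
    exact h.symm
  have hint' : Integrable (fun y => bondIncr s g V₀ y₀ (bondReflect y₀ b y) b) μ := by
    have h := (integrable_map_equiv (μ := μ) (bondReflectEquiv y₀ b) (fun y => bondIncr s g V₀ y₀ y b)).mp
      (by rw [coe_bondReflectEquiv, hμ]; exact hint)
    exact h
  simp only [oddIncr]
  rw [integral_div, integral_sub hint hint', hcomp, sub_self, zero_div]

omit [GaugeGroup G] [HaarData G] in
/-- Measurability of the increment in the fibre variable. [folklore] -/
theorem measurable_bondIncr (s : Finset (PBond P j)) {g : Density P j G} (hg : Measurable g) (V₀ : GaugeField P j G)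
    (y₀ : s → G) (b : s) : Measurable fun y : s → G => bondIncr s g V₀ y₀ y b := by
  have h1 : Measurable fun y : s → G => Function.update y₀ b (y b) := (measurable_update y₀).comp (measurable_pi_apply b)
  exact (hg.comp (measurable_updateFinset.comp h1)).sub measurable_const

/-- Bounded measurable functions on the fibre are integrable under the conditional law of a bounded density (it is zero
or a probability measure). [folklore] -/
theorem integrable_condLaw_of_bounded (s : Finset (PBond P j)) {w : Density P j G} {C : ℝ} (hC : ∀ U, w U ≤ C)
    (u : GaugeField P j G) {f : (s → G) → ℝ} (hf : Measurable f) {K : ℝ} (hK : ∀ y, |f y| ≤ K) :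
    Integrable f (condLaw s w u) := by
  haveI := isZeroOrProbabilityMeasure_condLaw s hC u
  exact (integrable_const K).mono' hf.aestronglyMeasurable (ae_of_all _ fun y => by
    rw [Real.norm_eq_abs]; exact hK y)

/-- THE ODD and EVEN READINGS (exterior-independent fibre readings, fixed reference `(V₀, y₀)`). [folklore] -/
noncomputable def oddReading (s : Finset (PBond P j)) (g : Density P j G) (V₀ : GaugeField P j G) (y₀ : s → G) :
    GaugeField P j G → s → ℝ :=
  fibreReading s fun y b => oddIncr s g V₀ y₀ y b

/-- [folklore] -/
noncomputable def evenReading (s : Finset (PBond P j)) (g : Density P j G) (V₀ : GaugeField P j G) (y₀ : s → G) :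
    GaugeField P j G → s → ℝ :=
  fibreReading s fun y b => evenIncr s g V₀ y₀ y b

omit [MeasurableSpace G] [HaarData G] in
/-- `incrReading = oddReading + evenReading` pointwise. [folklore] -/
theorem incrReading_eq_odd_add_even (s : Finset (PBond P j)) (g : Density P j G) (V₀ : GaugeField P j G)
    (y₀ : s → G) (U : GaugeField P j G) (b : s) :
    incrReading s g V₀ y₀ U b = oddReading s g V₀ y₀ U b + evenReading s g V₀ y₀ U b := by
  simp only [incrReading, oddReading, evenReading, fibreReading, oddIncr_add_evenIncr]

/-- **`MeanVanishes` OF THE ODD PART'S FIBRE MEANS AT A REFLECTION-SYMMETRIC REFERENCE LAW** (the format of the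
(β) supplier's `hflat`; `= condMeanField s w (oddReading …) u₀` by `condMeanField_fibreReading`) — the flatness input,
discharged EXACTLY for the odd part from the symmetry binder `hsym` (invariance of `condLaw s w u₀` under
every bond reflection through `y₀`; whether Bałaban's conditional laws at flat exteriors have it is obligation O-α of
the record, NOT touched). [folklore] -/
theorem meanVanishes_oddReading [RegularGaugeGroup G] (s : Finset (PBond P j)) {g : Density P j G}
    (hg : Measurable g) {Bg : ℝ} (hBg : ∀ U, |g U| ≤ Bg) (V₀ : GaugeField P j G) (y₀ : s → G) {w : Density P j G}
    {C : ℝ} (hC : ∀ U, w U ≤ C) (u₀ : GaugeField P j G)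
    (hsym : ∀ b : s, (condLaw s w u₀).map (bondReflect y₀ b) = condLaw s w u₀) :
    MeanVanishes Finset.univ fun b => ∫ y, oddIncr s g V₀ y₀ y b ∂condLaw s w u₀ := by
  intro b _
  exact integral_oddIncr_eq_zero s g V₀ y₀ b (hsym b)
    (integrable_condLaw_of_bounded s hC u₀ (measurable_bondIncr s hg V₀ y₀ b) fun y =>
      (abs_sub _ _).trans (add_le_add (hBg _) (hBg _)))

/-- **THE (β) SUPPLIER APPLIES TO THE ODD READING, BY NAME.**  Gibbs law `w = χ·e^{h}` live at `u₀`, the weight `g`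
measurable and bounded, response moduli `σ, τ ≥ 0`, and the reflection symmetry of `condLaw s w u₀` in every bond of
`s`: `CondMeanSuppression (respDom …) (condMeanField s w (oddReading s g V₀ y₀)) univ dev (σ·τ)` —
`T4CondMeanChannelInsert.condMeanSuppression_reading_of_varianceBound` with `hflat := meanVanishes_oddReading`.
[folklore] -/
theorem condMeanSuppression_oddReading_of_varianceBound [RegularGaugeGroup G] (s : Finset (PBond P j))
    {χ h : Density P j G} (hχm : Measurable χ) (hhm : Measurable h) (hχ0 : ∀ U, 0 ≤ χ U) {C : ℝ}
    (hC : ∀ U, χ U * Real.exp (h U) ≤ C) {u₀ : GaugeField P j G}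
    (hne : fibreIntegral s (fun U => χ U * Real.exp (h U)) u₀ ≠ 0) {g : Density P j G} (hg : Measurable g)
    {Bg : ℝ} (hBg : ∀ U, |g U| ≤ Bg) (V₀ : GaugeField P j G) (y₀ : s → G) {dev : GaugeField P j G → ℝ} {σ τ : ℝ}
    (hσ : 0 ≤ σ) (hτ : 0 ≤ τ)
    (hsym : ∀ b : s, (condLaw s (fun U => χ U * Real.exp (h U)) u₀).map (bondReflect y₀ b)
      = condLaw s (fun U => χ U * Real.exp (h U)) u₀) :
    CondMeanSuppression (respDom s χ h u₀ (fun y b => oddIncr s g V₀ y₀ y b) Finset.univ dev σ τ)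
      (condMeanField s (fun U => χ U * Real.exp (h U)) (oddReading s g V₀ y₀)) Finset.univ dev (σ * τ) := by
  have hK : ∀ (y : s → G) (b : s), |oddIncr s g V₀ y₀ y b| ≤ Bg + Bg := fun y b =>
    (abs_oddIncr_le_of_abs_bondIncr_le s g V₀ y₀ y b
      ((abs_sub _ _).trans (add_le_add (hBg _) (hBg _))) ((abs_sub _ _).trans (add_le_add (hBg _) (hBg _)))).1
  have hmo : ∀ b : s, Measurable fun y : s → G => oddIncr s g V₀ y₀ y b := fun b =>
    ((measurable_bondIncr s hg V₀ y₀ b).sub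
      ((measurable_bondIncr s hg V₀ y₀ b).comp (measurable_bondReflect y₀ b))).div_const 2
  exact condMeanSuppression_reading_of_varianceBound s hχm hhm hχ0 hC hne
    (fun b _ => (hmo b).aestronglyMeasurable) (fun b _ y => by rw [Real.norm_eq_abs]; exact hK y b) hσ hτ
    (meanVanishes_oddReading s hg hBg V₀ y₀ hC u₀ hsym)

/-- **THE EVEN READING'S CONDITIONAL MEAN — NOT SUPPRESSED BY FLATNESS, ONLY BY SIZE.**  With a majorant `D` of the
even part on the fibre, integrable under the conditional law at `u`: `|E^{w}[evenReading | u]_b| ≤ ∫ D d(condLaw s w u)`.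
With `D y = (c_b/2)` from `abs_evenIncr_le_of_secondDiff` this is (one-bond second-difference rate)/2; with
`D y = κ·bdist(y₀ b, y b)²` it is κ × the law's one-bond second moment about the reference. [folklore] -/
theorem abs_condMean_evenReading_le (s : Finset (PBond P j)) (g : Density P j G) (V₀ : GaugeField P j G)
    (y₀ : s → G) (w : Density P j G) (u : GaugeField P j G) (b : s) {D : (s → G) → ℝ}
    (hD : ∀ y, |evenIncr s g V₀ y₀ y b| ≤ D y) (hDi : Integrable D (condLaw s w u)) :
    |condMeanField s w (evenReading s g V₀ y₀) u b| ≤ ∫ y, D y ∂condLaw s w u := by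
  rw [evenReading, condMeanField_fibreReading, ← Real.norm_eq_abs]
  exact norm_integral_le_of_norm_le hDi (ae_of_all _ fun y => by rw [Real.norm_eq_abs]; exact hD y)

/-- **THE INCREMENT READING'S SUPPRESSION DATUM, ASSEMBLED FROM THE SPLIT**: odd part suppressed (`lip·dev`, e.g. by
`condMeanSuppression_oddReading_of_varianceBound`), even part bounded by `κ u` (e.g. by `abs_condMean_evenReading_le`)
⇒ `CondMeanSuppression dom (condMeanField s w (incrReading s g V₀ y₀)) univ (fun u => lip·dev u + κ u) 1` — the
law-side hypothesis `hsupᵢ` of `condMeanGap_of_separable` / `condMeanGap_of_loopProd` with the DIAGONAL made explicit: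
the deviation functional carries the FLOOR `κ` (it does NOT vanish at the reference exterior). [folklore] -/
theorem condMeanSuppression_incrReading_of_split [RegularGaugeGroup G] (s : Finset (PBond P j))
    {g : Density P j G} (hg : Measurable g) {Bg : ℝ} (hBg : ∀ U, |g U| ≤ Bg) (V₀ : GaugeField P j G) (y₀ : s → G)
    {w : Density P j G} {C : ℝ} (hC : ∀ U, w U ≤ C) {dom : Set (GaugeField P j G)}
    {dev κ : GaugeField P j G → ℝ} {lip : ℝ}
    (hodd : CondMeanSuppression dom (condMeanField s w (oddReading s g V₀ y₀)) Finset.univ dev lip)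
    (heven : ∀ u ∈ dom, ∀ b : s, |condMeanField s w (evenReading s g V₀ y₀) u b| ≤ κ u) :
    CondMeanSuppression dom (condMeanField s w (incrReading s g V₀ y₀)) Finset.univ
      (fun u => lip * dev u + κ u) 1 := by
  intro u hu b hb
  have hKi : ∀ y : s → G, |bondIncr s g V₀ y₀ y b| ≤ Bg + Bg := fun y =>
    (abs_sub _ _).trans (add_le_add (hBg _) (hBg _))
  have hmo : Measurable fun y : s → G => oddIncr s g V₀ y₀ y b :=
    ((measurable_bondIncr s hg V₀ y₀ b).sub
      ((measurable_bondIncr s hg V₀ y₀ b).comp (measurable_bondReflect y₀ b))).div_const 2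
  have hme : Measurable fun y : s → G => evenIncr s g V₀ y₀ y b :=
    ((measurable_bondIncr s hg V₀ y₀ b).add
      ((measurable_bondIncr s hg V₀ y₀ b).comp (measurable_bondReflect y₀ b))).div_const 2
  have hio : Integrable (fun y => oddIncr s g V₀ y₀ y b) (condLaw s w u) :=
    integrable_condLaw_of_bounded s hC u hmo fun y =>
      (abs_oddIncr_le_of_abs_bondIncr_le s g V₀ y₀ y b (hKi y) (hKi _)).1
  have hie : Integrable (fun y => evenIncr s g V₀ y₀ y b) (condLaw s w u) :=
    integrable_condLaw_of_bounded s hC u hme fun y =>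
      (abs_oddIncr_le_of_abs_bondIncr_le s g V₀ y₀ y b (hKi y) (hKi _)).2
  have hsplit : condMeanField s w (incrReading s g V₀ y₀) u b
      = condMeanField s w (oddReading s g V₀ y₀) u b + condMeanField s w (evenReading s g V₀ y₀) u b := by
    simp only [incrReading, oddReading, evenReading, condMeanField_fibreReading]
    rw [← integral_add hio hie]
    simp only [oddIncr_add_evenIncr]
  rw [hsplit, one_mul, Real.norm_eq_abs]
  have h₁ : |condMeanField s w (oddReading s g V₀ y₀) u b| ≤ lip * dev u := by
    simpa only [Real.norm_eq_abs] using hodd u hu b hb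
  exact (abs_add_le _ _).trans (add_le_add h₁ (heven u hu b))

end Diagonal

/-! ## §6 [v1.3, append-only] The reflection symmetry discharged down to the WEIGHT

The symmetry binder `hsym` of §5 (invariance of the reference conditional law under every bond reflection through
`y₀`) is reduced to a property of the DENSITY alone: the product Haar measure on the fibre is invariant under
`bondReflect y₀ b` (kernel: Haar is left-, right- and inversion-invariant — the fields of `HaarData` — and
`h ↦ a·h⁻¹·a` is the composite; `Measure.pi` is preserved factorwise), so `fibreLaw` / `condLaw` are invariant as soon
as the density is (`map_bondReflect_fibreLaw`, `map_bondReflect_condLaw`).  A sufficient condition on the density: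
RADIALITY in the `b`-variable about `y₀ b` (dependence on `y_b` only through `bdist (y₀ b) (y_b)` given the other
fibre variables; `weightSymm_of_radial`).  CONTEXT, not asserted: for a one-bond fibre with conditional density
`exp(β·Re Tr(h·A))`, `A` the staple sum, radiality about the polar part of `A` holds when `A` is a multiple of a
unitary (e.g. `U(1)`, `SU(2)`), not in general. -/

section Symmetry

open B15.BasicStep T4DressedR T4DressingDefect T4FirstOrderSize T4CondLawRelative T4ObservableTelescope
open T4CondMeanChannel T4CondMeanChannelInsert T4CovarianceResponse T4Continuum T4AvgSensitivity T4AvgDerivBound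

variable {P : Params} {j : ℕ} {G : Type*} [GaugeGroup G] [MeasurableSpace G] [HaarData G]
variable [DecidableEq (PBond P j)]

omit [DecidableEq (PBond P j)] in
/-- The one-variable reflection `h ↦ a·h⁻¹·a` preserves the Haar datum (inversion, then left and right translation by
`a`: the three invariance fields of `HaarData`). [folklore] -/
theorem measurePreserving_reflect [RegularGaugeGroup G] (a : G) :
    MeasurePreserving (fun h : G => a * h⁻¹ * a) (HaarData.haar : Measure G) HaarData.haar := by
  have hi : MeasurePreserving (fun h : G => h⁻¹) (HaarData.haar : Measure G) HaarData.haar :=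
    ⟨measurable_inv, HaarData.map_inv⟩
  have hl : MeasurePreserving (fun h : G => a * h) (HaarData.haar : Measure G) HaarData.haar :=
    ⟨measurable_const_mul a, HaarData.map_mul_left a⟩
  have hr : MeasurePreserving (fun h : G => h * a) (HaarData.haar : Measure G) HaarData.haar :=
    ⟨measurable_mul_const a, HaarData.map_mul_right a⟩
  exact (hr.comp hl).comp hi

/-- **The bond reflection preserves the product Haar measure on the fibre.** [folklore] -/
theorem measurePreserving_bondReflect [RegularGaugeGroup G] {s : Finset (PBond P j)} (y₀ : s → G) (b : s) :
    MeasurePreserving (bondReflect y₀ b) (Measure.pi fun _ : s => (HaarData.haar : Measure G))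
      (Measure.pi fun _ : s => (HaarData.haar : Measure G)) := by
  haveI := HaarData.isProb (G := G)
  have h := measurePreserving_pi (fun _ : s => (HaarData.haar : Measure G))
    (fun _ : s => (HaarData.haar : Measure G))
    (f := fun c => if c = b then (fun h : G => y₀ b * h⁻¹ * y₀ b) else id) fun c => by
      by_cases hc : c = b
      · subst hc; simp only [if_true]; exact measurePreserving_reflect (y₀ c)
      · simp only [hc, if_false]; exact MeasurePreserving.id _
  have hfun : bondReflect y₀ b = fun (y : s → G) c =>
      (if c = b then (fun h : G => y₀ b * h⁻¹ * y₀ b) else id) (y c) := by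
    funext y c
    by_cases hc : c = b
    · subst hc; simp [bondReflect]
    · simp [bondReflect, hc]
  rw [hfun]; exact h

/-- **The fibre law is reflection-invariant as soon as the density is** (on the fibre through `V`).  The change of
variables in the lower Lebesgue integral along the measurable self-equivalence `bondReflectEquiv y₀ b` is the argument
of `…QuantumFieldTheory.WilsonGauge.withDensity_map_equiv_of_invariant` (a module outside this cell's import cone, not
imported), carried out in place; no measurability of the density is needed. [folklore] -/
theorem map_bondReflect_fibreLaw [RegularGaugeGroup G] (s : Finset (PBond P j)) (old : Density P j G)
    (V : GaugeField P j G) (y₀ : s → G) (b : s)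
    (hw : ∀ y : s → G, old (updateFinset V s (bondReflect y₀ b y)) = old (updateFinset V s y)) :
    (fibreLaw s old V).map (bondReflect y₀ b) = fibreLaw s old V := by
  have hπ := (measurePreserving_bondReflect y₀ b (s := s)).map_eq
  rw [← coe_bondReflectEquiv] at hπ ⊢
  unfold fibreLaw
  ext t ht
  rw [Measure.map_apply (bondReflectEquiv y₀ b).measurable ht,
    withDensity_apply _ ((bondReflectEquiv y₀ b).measurable ht), withDensity_apply _ ht]
  conv_rhs => rw [← hπ]
  rw [Measure.restrict_map (bondReflectEquiv y₀ b).measurable ht, lintegral_map_equiv]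
  simp only [coe_bondReflectEquiv, hw]

/-- **The conditional law is reflection-invariant as soon as the density is** — the DISCHARGE of §5's binder `hsym`
down to the weight. [folklore] -/
theorem map_bondReflect_condLaw [RegularGaugeGroup G] (s : Finset (PBond P j)) (old : Density P j G)
    (V : GaugeField P j G) (y₀ : s → G) (b : s)
    (hw : ∀ y : s → G, old (updateFinset V s (bondReflect y₀ b y)) = old (updateFinset V s y)) :
    (condLaw s old V).map (bondReflect y₀ b) = condLaw s old V := by
  rw [condLaw, Measure.map_smul, map_bondReflect_fibreLaw s old V y₀ b hw]

omit [MeasurableSpace G] [HaarData G] in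
/-- **RADIAL DENSITIES ARE REFLECTION-SYMMETRIC**: if on the fibre through `V` the density depends on the `b`-variable
only through `bdist (y₀ b) (y b)` given the other fibre variables, it is invariant under the bond reflection through
`y₀` at `b` (`bdist_bondReflect`; the other variables are untouched). [folklore] -/
theorem weightSymm_of_radial (s : Finset (PBond P j)) (old : Density P j G) (V : GaugeField P j G) (y₀ : s → G)
    (b : s) (F : (s → G) → ℝ → ℝ)
    (hF : ∀ y : s → G, old (updateFinset V s y) = F (Function.update y b (y₀ b)) (bdist (y₀ b) (y b))) :
    ∀ y : s → G, old (updateFinset V s (bondReflect y₀ b y)) = old (updateFinset V s y) := by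
  intro y
  rw [hF, hF, bdist_bondReflect]
  simp only [bondReflect, Function.update_idem]

/-- **THE (β) SUPPLIER FOR THE ODD READING, SYMMETRY DISCHARGED TO THE WEIGHT**: §5's
`condMeanSuppression_oddReading_of_varianceBound` with `hsym` supplied by `map_bondReflect_condLaw` from the reflection
symmetry of the weight `χ·e^{h}` on the reference fibre through `u₀` in every bond of `s` (binder `hwsym`; e.g. from
`weightSymm_of_radial`).  Nothing about which of the printed conditional laws are symmetric is asserted. [folklore] -/
theorem condMeanSuppression_oddReading_of_weightSymm [RegularGaugeGroup G] (s : Finset (PBond P j))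
    {χ h : Density P j G} (hχm : Measurable χ) (hhm : Measurable h) (hχ0 : ∀ U, 0 ≤ χ U) {C : ℝ}
    (hC : ∀ U, χ U * Real.exp (h U) ≤ C) {u₀ : GaugeField P j G}
    (hne : fibreIntegral s (fun U => χ U * Real.exp (h U)) u₀ ≠ 0) {g : Density P j G} (hg : Measurable g)
    {Bg : ℝ} (hBg : ∀ U, |g U| ≤ Bg) (V₀ : GaugeField P j G) (y₀ : s → G) {dev : GaugeField P j G → ℝ} {σ τ : ℝ}
    (hσ : 0 ≤ σ) (hτ : 0 ≤ τ)
    (hwsym : ∀ (b : s) (y : s → G),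
      χ (updateFinset u₀ s (bondReflect y₀ b y)) * Real.exp (h (updateFinset u₀ s (bondReflect y₀ b y)))
        = χ (updateFinset u₀ s y) * Real.exp (h (updateFinset u₀ s y))) :
    CondMeanSuppression (respDom s χ h u₀ (fun y b => oddIncr s g V₀ y₀ y b) Finset.univ dev σ τ)
      (condMeanField s (fun U => χ U * Real.exp (h U)) (oddReading s g V₀ y₀)) Finset.univ dev (σ * τ) :=
  condMeanSuppression_oddReading_of_varianceBound s hχm hhm hχ0 hC hne hg hBg V₀ y₀ hσ hτ
    fun b => map_bondReflect_condLaw s (fun U => χ U * Real.exp (h U)) u₀ y₀ b (hwsym b)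

end Symmetry

end Literature.MathematicalPhysics.QuantumFieldTheory.Balaban1983to89.T4SeparableFibreExpansion
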